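import Literature.Analysis.FluidPDE.SteadyNSLatticePersistence
import HarnessLib

/-!
# The steady Navier–Stokes equations on the Fourier lattice `ℤ³` in a conserved-mean leaf:
# persistence of leaf-nondegenerate steady states with arbitrary mean (the drifted steady system)

Analysis/FluidPDE proof file (theorems only; no definitions, no named facts), continuing
`Literature/Analysis/FluidPDE/SteadyNSLatticePersistence.lean` (`SteadyLattice.*`).

On `T³` the space average `m = ⨍ u` of a classical solution of `NS_ν` forced by a mean-zero
force is conserved, and a classical *steady* state `u` of `NS_ν(f)` may have any mean `m ∈ ℝ³`
(e.g. the drifted Kolmogorov flows `(V(y), m, 0)`). Writing `u = m + v` with `⨍ v = 0` turns the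
steady system into the **drifted steady system** of the leaf `{⨍ u = m}`,

  `−νΔv + (m·∇)v + (v·∇)v + ∇p = f,  div v = 0,  ⨍ v = 0,`

whose linearisation at `v₀` is the linearised Navier–Stokes operator
`L(ν,u₀) w = νΔw − (u₀·∇)w − (w·∇)u₀ − ∇q` of the tree (`Torus.linearizedNSOperator`, with
`u₀ = m + v₀`: the drift `(m·∇)w` is part of `(u₀·∇)w` and `(w·∇)m = 0`) acting on mean-zero `w`.
Hence `¬ Torus.IsLinNSEigenvalue ν u₀ 0` is nondegeneracy *in the leaf* for every mean, and the
steady implicit-function theorem at fixed viscosity (Temam 1979, Ch. II §1, Thm. 1.3 and its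
proof; Foias–Temam 1977, §1; Saut–Temam 1980, §2) runs in every leaf: leaf-nondegenerate
classical steady states persist, with the same mean, `H¹`-continuously under small changes of
the force (`steadyPersistsInLeaf_of_nondeg`).

On the Fourier lattice the drift is the diagonal multiplier `v̂(k) ↦ 2πi (k·m) v̂(k)`: one weight
down from the Stokes operator, hence compact against it, energy-neutral, and — the bookkeeping
device used throughout — equal to the linearised convective symbol against the single mode
`δ₀ m` (`N(δ₀m, c)(k) = 2πi (k·m) c(k)`, `N(c, δ₀m) = 0`), so that the full coefficient family
`û = v̂ + δ₀ m` of `u = m + v` carries the drift inside `N(û, ·)`, `N(û, û)`: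

* §A: single modes `Pi.single 0 M`, the punctured family `Function.update a 0 0`, the drift
  symbol, and the splitting of `N(a, ·) + N(·, a)` and `N(a, a)` along `a = a° + δ₀ a(0)`;
* §B: the drift multiplier `D_M x (k) = 2πi (k·M) x̌(k)` on the state space `W` of
  `SteadyLattice` (bounded, `W`-valued, compact: it gains one weight);
* §C: lattice elliptic regularity for the perturbed steady equation
  `4π²ν x + Π(N(a, x̌) + N(x̌, a)) + Π N(x̌, x̌) = F` (one more first-order term in the bootstrap of
  `SteadyLattice.rapidDecay_of_steady_eq` / `rapidDecay_of_linearised_eq`);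
* §D: the dictionary without mean conditions: classical steady states of any mean solve the
  projected lattice equations for the full family `û` (`fourier_eq_of_isSteadyNSState'`), and
  rapidly decaying solutions with any zero mode synthesise classical steady states with
  `𝓕u = c`, hence `⨍ u = Re c(0)` (`steadyState_of_fourier'`); the same two facts in the drifted
  form "punctured family `û°` + drift `2πi (k·M)`, `M = û(0)`" (`fourier_eq_drift_of_isSteadyNSState`,
  `steadyState_of_fourier_drift`);
* §E: the assembly `steadyPersistsInLeaf_of_nondeg` for the Leray-projected trigonometric
  polynomial forces `c ↦ realTrigPoly S (Π ĉ)` of `SteadyLattice` (§J there).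

Not here: existence of steady states with prescribed mean for every force (the drifted
Leray–Schauder / Galerkin argument), time-dependent problems, uniqueness of the branch.

## References

* R. Temam, *Navier–Stokes Equations: Theory and Numerical Analysis*, North-Holland (1979),
  Ch. II §1 (Thm. 1.3 and its proof: regular points of the steady map; Prop. 1.1 regularity).
  [Temam1979]
* C. Foias, R. Temam, *Structure of the set of stationary solutions of the Navier–Stokes
  equations*, Comm. Pure Appl. Math. 30 (1977) 149–164, §1. [FoiasTemam1977]
* J.-C. Saut, R. Temam, *Generic properties of Navier–Stokes equations: genericity with respect
  to the boundary values*, Indiana Univ. Math. J. 29 (1980) 427–446, §2. [SautTemam1980]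
-/

noncomputable section

open scoped BigOperators Topology ENNReal NNReal InnerProductSpace ComplexConjugate
open Filter Set Function TopologicalSpace MeasureTheory UnitAddTorus

namespace Literature.Analysis.FluidPDE

namespace SteadyLatticeDrift

open Literature.Analysis.FunctionSpaces Literature.Analysis.FunctionSpaces.Torus
open Literature.Analysis.FunctionSpaces.EuclideanSpace
open Literature.Analysis.FluidPDE.ScalarFourier
open Literature.Analysis.FluidPDE.SteadyLattice

/-! ## §A Single modes, punctured families and the drift symbol -/

section Single

/-- `0 · v = 0`. [folklore] -/
theorem kdot_zero_left (v : (EuclideanSpace ℂ (Fin 3))) : (∑ jj : Fin 3, (((0 : (Fin 3 → ℤ)) jj : ℤ) : ℂ) * v jj) =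
    0 := by simp

/-- `(-k) · v = -(k · v)`. [folklore] -/
theorem kdot_neg (k : (Fin 3 → ℤ)) (v : (EuclideanSpace ℂ (Fin 3))) : (∑ jj : Fin 3, (((-k) jj : ℤ) : ℂ) * v jj) = -(∑
    jj : Fin 3, ((k jj : ℤ) : ℂ) * v jj) := by
  simp only [Pi.neg_apply, Int.cast_neg, neg_mul, Finset.sum_neg_distrib]

/-- `conj (k · v) = k · conj v`. [folklore] -/
theorem conj_kdot (k : (Fin 3 → ℤ)) (v : (EuclideanSpace ℂ (Fin 3))) : conj ((∑ jj : Fin 3, ((k jj : ℤ) : ℂ) * v jj))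
    = (∑ jj : Fin 3, ((k jj : ℤ) : ℂ) * (conjVec v) jj) := by
  rw [map_sum]
  refine Finset.sum_congr rfl fun j _ => ?_
  rw [map_mul, conjVec_apply, map_intCast]

/-- **The drift coefficient is conjugate-odd in `k` for a real vector**:
`2πi ((-k)·M) = conj (2πi (k·M))` when `conj M = M`. [folklore] -/
theorem driftCoeff_neg (k : (Fin 3 → ℤ)) {M : (EuclideanSpace ℂ (Fin 3))} (hM : conjVec M = M) :
    (2 * Real.pi * Complex.I * (∑ jj : Fin 3, (((-k) jj : ℤ) : ℂ) * M jj) : ℂ) = conj (2 * Real.pi * Complex.I * (∑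
        jj : Fin 3, ((k jj : ℤ) : ℂ) * M jj)) := by
  rw [kdot_neg, map_mul, conj_kdot, hM]
  simp only [map_mul, Complex.conj_ofReal, Complex.conj_I, map_ofNat]
  ring

/-- `‖2πi (k·M)‖ ≤ 2π · 3⟨k⟩ ‖M‖`. [folklore] -/
theorem norm_driftCoeff_le (M : (EuclideanSpace ℂ (Fin 3))) (k : (Fin 3 → ℤ)) :
    ‖(2 * Real.pi * Complex.I * (∑ jj : Fin 3, ((k jj : ℤ) : ℂ) * M jj) : ℂ)‖ ≤ 2 * Real.pi * (3 * sobolevWeight 1 k *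
        ‖M‖) := by
  rw [norm_mul, show ‖(2 * Real.pi * Complex.I : ℂ)‖ = 2 * Real.pi by simp [abs_of_pos Real.pi_pos]]
  exact mul_le_mul_of_nonneg_left (norm_kdot_le k M) (by positivity)

/-- Single modes at the zero frequency are transversal. [folklore] -/
theorem single_transversal (M : (EuclideanSpace ℂ (Fin 3))) (k : (Fin 3 → ℤ)) : (∑ jj : Fin 3, ((k jj : ℤ) : ℂ) *
    ((Pi.single (0 : (Fin 3 → ℤ)) M : (Fin 3 → ℤ) → (EuclideanSpace ℂ (Fin 3))) k) jj) = 0 := by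
  by_cases hk : k = 0
  · subst hk; simp
  · rw [Pi.single_eq_of_ne hk, kdot_zero]

/-- Single modes decay rapidly (pattern of `Lattice.rapidDecay_single`). [folklore] -/
theorem rapidDecay_single (M : (EuclideanSpace ℂ (Fin 3))) : RapidDecay (Pi.single (0 : (Fin 3 → ℤ)) M : (Fin 3 → ℤ) →
    (EuclideanSpace ℂ (Fin 3))) := fun n =>
  summable_of_ne_finset_zero (s := {0}) fun k hk => by
    have : k ≠ 0 := by simpa using hk
    simp [Pi.single_eq_of_ne this]

/-- A single mode with a real vector (`conj M = M`) is conjugate symmetric. [folklore] -/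
theorem isConjSymm_single {M : (EuclideanSpace ℂ (Fin 3))} (hM : conjVec M = M) : IsConjSymm (Pi.single (0 : (Fin 3 →
    ℤ)) M : (Fin 3 → ℤ) → (EuclideanSpace ℂ (Fin 3))) := by
  intro k
  by_cases hk : k = 0
  · subst hk; simp [hM]
  · rw [Pi.single_eq_of_ne hk, Pi.single_eq_of_ne (neg_ne_zero.2 hk), conjVec_zero]

/-- `a = a° + δ₀ a(0)` with `a° = Function.update a 0 0` the punctured family. [folklore] -/
theorem update_add_single (a : (Fin 3 → ℤ) → (EuclideanSpace ℂ (Fin 3))) : Function.update a 0 0 + (Pi.single (0 :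
    (Fin 3 → ℤ)) (a 0) : (Fin 3 → ℤ) → (EuclideanSpace ℂ (Fin 3))) = a := by
  funext k
  by_cases hk : k = 0
  · subst hk; simp
  · simp [hk]

/-- Puncturing `b + δ₀ M` returns `b` when `b 0 = 0`. [folklore] -/
theorem update_add_single_of_zero {b : (Fin 3 → ℤ) → (EuclideanSpace ℂ (Fin 3))} (hb0 : b 0 = 0) (M : (EuclideanSpace
    ℂ (Fin 3))) :
    Function.update (b + (Pi.single (0 : (Fin 3 → ℤ)) M : (Fin 3 → ℤ) → (EuclideanSpace ℂ (Fin 3)))) 0 0 = b := by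
  funext k
  by_cases hk : k = 0
  · subst hk; rw [Function.update_self, hb0]
  · rw [Function.update_of_ne hk, Pi.add_apply, Pi.single_eq_of_ne hk, add_zero]

/-- The zero mode of `b + δ₀ M` is `M` when `b 0 = 0`. [folklore] -/
theorem add_single_apply_zero {b : (Fin 3 → ℤ) → (EuclideanSpace ℂ (Fin 3))} (hb0 : b 0 = 0) (M : (EuclideanSpace ℂ
    (Fin 3))) : (b + (Pi.single (0 : (Fin 3 → ℤ)) M : (Fin 3 → ℤ) → (EuclideanSpace ℂ (Fin 3)))) 0 = M := by
  rw [Pi.add_apply, hb0, zero_add, Pi.single_eq_same]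

/-- Puncturing preserves rapid decay. [folklore] -/
theorem rapidDecay_update {a : (Fin 3 → ℤ) → (EuclideanSpace ℂ (Fin 3))} (ha : RapidDecay a) : RapidDecay
    (Function.update a 0 0) :=
  ha.of_norm_le_mul (C := 1) fun k => by
    by_cases hk : k = 0
    · subst hk; simp
    · simp [hk]

/-- Puncturing preserves conjugate symmetry. [folklore] -/
theorem isConjSymm_update {a : (Fin 3 → ℤ) → (EuclideanSpace ℂ (Fin 3))} (ha : IsConjSymm a) : IsConjSymm
    (Function.update a 0 0) := by
  intro k
  by_cases hk : k = 0
  · subst hk; simp [conjVec_zero]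
  · rw [Function.update_of_ne (neg_ne_zero.2 hk), Function.update_of_ne hk, ha k]

/-- Puncturing preserves transversality. [folklore] -/
theorem update_transversal {a : (Fin 3 → ℤ) → (EuclideanSpace ℂ (Fin 3))} (hat : ∀ m : (Fin 3 → ℤ), (∑ jj : Fin 3, ((m
    jj : ℤ) : ℂ) * (a m) jj) = 0) (k : (Fin 3 → ℤ)) :
    (∑ jj : Fin 3, ((k jj : ℤ) : ℂ) * (Function.update a 0 0 k) jj) = 0 := by
  by_cases hk : k = 0
  · subst hk; simp
  · rw [Function.update_of_ne hk]; exact hat k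

/-- `Π_k` fixes a transversal punctured family (`Π₀ = 0`). [folklore] -/
theorem lerayCoeff_update {a : (Fin 3 → ℤ) → (EuclideanSpace ℂ (Fin 3))} (hat : ∀ m : (Fin 3 → ℤ), (∑ jj : Fin 3, ((m
    jj : ℤ) : ℂ) * (a m) jj) = 0) (k : (Fin 3 → ℤ)) :
    Torus.lerayCoeff k (Function.update a 0 0 k) = Function.update a 0 0 k := by
  by_cases hk : k = 0
  · subst hk; rw [Function.update_self, lerayCoeff_zero_vec]
  · rw [Function.update_of_ne hk]; exact lerayCoeff_of_kdot_eq_zero hk (hat k)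

/-- `Π_k` fixes the physical coefficients `cf x` of a transversal family. [folklore] -/
theorem lerayCoeff_cf {x : (Fin 3 → ℤ) → (EuclideanSpace ℂ (Fin 3))} (hxt : ∀ k : (Fin 3 → ℤ), (∑ jj : Fin 3, ((k jj :
    ℤ) : ℂ) * (x k) jj) = 0) (k : (Fin 3 → ℤ)) :
    Torus.lerayCoeff k ((((fun mm : Fin 3 → ℤ => (((freqNormSq mm)⁻¹ : ℝ) : ℂ)) • (x : (Fin 3 → ℤ) → EuclideanSpace ℂ
        (Fin 3)))) k) = (((fun mm : Fin 3 → ℤ => (((freqNormSq mm)⁻¹ : ℝ) : ℂ)) • (x : (Fin 3 → ℤ) → EuclideanSpace ℂ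
        (Fin 3)))) k := by
  by_cases hk : k = 0
  · subst hk; rw [cf_zero, lerayCoeff_zero_vec]
  · exact lerayCoeff_of_kdot_eq_zero hk (cf_transversal hxt k)

/-- The Stokes weight kills the zero mode: `ν4π²|k|² a°(k) = ν4π²|k|² a(k)`. [folklore] -/
theorem weight_smul_update {ν : ℝ} (a : (Fin 3 → ℤ) → (EuclideanSpace ℂ (Fin 3))) (k : (Fin 3 → ℤ)) :
    (((ν * (4 * Real.pi ^ 2 * freqNormSq k)) : ℝ) : ℂ) • Function.update a 0 0 k =
      (((ν * (4 * Real.pi ^ 2 * freqNormSq k)) : ℝ) : ℂ) • a k := by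
  by_cases hk : k = 0
  · subst hk; simp [freqNormSq_zero]
  · rw [Function.update_of_ne hk]

/-- The element `k ↦ |k|² â(k)` represents the punctured family `a°` through `cf`. [folklore] -/
theorem cf_weight_smul' (a : (Fin 3 → ℤ) → (EuclideanSpace ℂ (Fin 3))) :
    ((fun mm : Fin 3 → ℤ => (((freqNormSq mm)⁻¹ : ℝ) : ℂ)) • ((fun k : (Fin 3 → ℤ) => ((freqNormSq k : ℝ) : ℂ) • a
        k) : (Fin 3 → ℤ) → EuclideanSpace ℂ (Fin 3))) = Function.update a 0 0 := by
  funext k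
  rw [cf_apply]
  by_cases hk : k = 0
  · subst hk; simp [freqNormSq_zero]
  · have hf : freqNormSq k ≠ 0 := ne_of_gt (lt_of_lt_of_le one_pos (one_le_freqNormSq' hk))
    rw [Function.update_of_ne hk, smul_smul, ← Complex.ofReal_mul, inv_mul_cancel₀ hf, Complex.ofReal_one, one_smul]

/-- **The drift symbol**: `N(δ₀ M, c)(k) = 2πi (k·M) c(k)` (Fourier side of `(m·∇)w`). [folklore] -/
theorem nl_single_left (M : (EuclideanSpace ℂ (Fin 3))) (c : (Fin 3 → ℤ) → (EuclideanSpace ℂ (Fin 3))) (k : (Fin 3 →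
    ℤ)) :
    (WithLp.toLp 2 (fun pp : Fin 3 => transportSym (fun jj mm => (Pi.single (0 : (Fin 3 → ℤ)) M : (Fin 3 → ℤ) →
        (EuclideanSpace ℂ (Fin 3))) mm jj) (fun mm => c mm pp) k) : EuclideanSpace ℂ (Fin 3)) = (2 * Real.pi *
        Complex.I * (∑ jj : Fin 3, ((k jj : ℤ) : ℂ) * M jj)) • c k := by
  ext p
  rw [nl_apply, PiLp.smul_apply, smul_eq_mul]
  have h : ∀ j, ∑' m, (Pi.single (0 : (Fin 3 → ℤ)) M : (Fin 3 → ℤ) → (EuclideanSpace ℂ (Fin 3))) m j * (dsym j (k - m)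
      * c (k - m) p) =
      M j * (dsym j k * c k p) := by
    intro j
    rw [tsum_eq_single 0]
    · simp
    · intro m hm
      rw [Pi.single_eq_of_ne hm]
      simp
  rw [Finset.sum_congr rfl fun j _ => h j]
  simp only [dsym_apply, Finset.sum_mul, Finset.mul_sum]
  exact Finset.sum_congr rfl fun j _ => by ring

/-- `N(c, δ₀ M)(k) = 0` (Fourier side of `(w·∇)m = 0`). [folklore] -/
theorem nl_single_right (c : (Fin 3 → ℤ) → (EuclideanSpace ℂ (Fin 3))) (M : (EuclideanSpace ℂ (Fin 3))) (k : (Fin 3 →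
    ℤ)) : (WithLp.toLp 2 (fun pp : Fin 3 => transportSym (fun jj mm => c mm jj) (fun mm => (Pi.single (0 : (Fin 3 →
    ℤ)) M : (Fin 3 → ℤ) → (EuclideanSpace ℂ (Fin 3))) mm pp) k) : EuclideanSpace ℂ (Fin 3)) = 0 := by
  ext p
  rw [nl_apply, PiLp.zero_apply]
  refine Finset.sum_eq_zero fun j _ => ?_
  rw [tsum_eq_single k]
  · simp [dsym_apply]
  · intro m hm
    have : k - m ≠ 0 := sub_ne_zero.2 (Ne.symm hm)
    rw [Pi.single_eq_of_ne this]
    simp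

/-- Summability of the symbol's terms with a single mode first. [folklore] -/
theorem summable_nl_single_left (M : (EuclideanSpace ℂ (Fin 3))) (c : (Fin 3 → ℤ) → (EuclideanSpace ℂ (Fin 3))) (k :
    (Fin 3 → ℤ)) (j p : Fin 3) :
    Summable fun m => (Pi.single (0 : (Fin 3 → ℤ)) M : (Fin 3 → ℤ) → (EuclideanSpace ℂ (Fin 3))) m j * (dsym j (k - m)
        * c (k - m) p) :=
  summable_of_ne_finset_zero (s := {0}) fun m hm => by
    have : m ≠ 0 := by simpa using hm
    simp [Pi.single_eq_of_ne this]

/-- Summability of the symbol's terms with a single mode second. [folklore] -/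
theorem summable_nl_single_right (c : (Fin 3 → ℤ) → (EuclideanSpace ℂ (Fin 3))) (M : (EuclideanSpace ℂ (Fin 3))) (k :
    (Fin 3 → ℤ)) (j p : Fin 3) :
    Summable fun m => c m j * (dsym j (k - m) * (Pi.single (0 : (Fin 3 → ℤ)) M : (Fin 3 → ℤ) → (EuclideanSpace ℂ (Fin
        3))) (k - m) p) :=
  summable_of_ne_finset_zero (s := {k}) fun m hm => by
    have : k - m ≠ 0 := sub_ne_zero.2 (Ne.symm (by simpa using hm))
    simp [Pi.single_eq_of_ne this]

/-- **Splitting the linearised symbol along `b + δ₀ M`**: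
`N(b + δ₀M, c) + N(c, b + δ₀M) = N(b, c) + N(c, b) + 2πi (k·M) c(k)`. [folklore] -/
theorem nl_linearised_add_single {b c : (Fin 3 → ℤ) → (EuclideanSpace ℂ (Fin 3))} (M : (EuclideanSpace ℂ (Fin 3)))
    (k : (Fin 3 → ℤ))
    (h₁ : ∀ j p, Summable fun m => b m j * (dsym j (k - m) * c (k - m) p))
    (h₂ : ∀ j p, Summable fun m => c m j * (dsym j (k - m) * b (k - m) p)) :
    (WithLp.toLp 2 (fun pp : Fin 3 => transportSym (fun jj mm => (b + (Pi.single (0 : (Fin 3 → ℤ)) M : (Fin 3 → ℤ) →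
        (EuclideanSpace ℂ (Fin 3)))) mm jj) (fun mm => c mm pp) k) : EuclideanSpace ℂ (Fin 3)) + (WithLp.toLp 2 (fun
        pp : Fin 3 => transportSym (fun jj mm => c mm jj) (fun mm => (b + (Pi.single (0 : (Fin 3 → ℤ)) M : (Fin 3 → ℤ)
        → (EuclideanSpace ℂ (Fin 3)))) mm pp) k) : EuclideanSpace ℂ (Fin 3)) =
      (WithLp.toLp 2 (fun pp : Fin 3 => transportSym (fun jj mm => b mm jj) (fun mm => c mm pp) k) : EuclideanSpace ℂ
          (Fin 3)) + (WithLp.toLp 2 (fun pp : Fin 3 => transportSym (fun jj mm => c mm jj) (fun mm => b mm pp) k) :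
          EuclideanSpace ℂ (Fin 3)) + (2 * Real.pi * Complex.I * (∑ jj : Fin 3, ((k jj : ℤ) : ℂ) * M jj)) • c k := by
  rw [nl_add_left _ _ _ k h₁ (summable_nl_single_left M c k),
    nl_add_right _ _ _ k h₂ (summable_nl_single_right c M k), nl_single_left, nl_single_right, add_zero]
  abel

/-- **Splitting the steady symbol along `b + δ₀ M`**:
`N(b + δ₀M, b + δ₀M)(k) = N(b, b)(k) + 2πi (k·M) b(k)`. [folklore] -/
theorem nl_add_single_self {b : (Fin 3 → ℤ) → (EuclideanSpace ℂ (Fin 3))} (M : (EuclideanSpace ℂ (Fin 3))) (k : (Fin 3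
    → ℤ))
    (h : ∀ j p, Summable fun m => b m j * (dsym j (k - m) * b (k - m) p)) :
    (WithLp.toLp 2 (fun pp : Fin 3 => transportSym (fun jj mm => (b + (Pi.single (0 : (Fin 3 → ℤ)) M : (Fin 3 → ℤ) →
        (EuclideanSpace ℂ (Fin 3)))) mm jj) (fun mm => (b + (Pi.single (0 : (Fin 3 → ℤ)) M : (Fin 3 → ℤ) →
        (EuclideanSpace ℂ (Fin 3)))) mm pp) k) : EuclideanSpace ℂ (Fin 3)) =
      (WithLp.toLp 2 (fun pp : Fin 3 => transportSym (fun jj mm => b mm jj) (fun mm => b mm pp) k) : EuclideanSpace ℂ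
          (Fin 3)) + (2 * Real.pi * Complex.I * (∑ jj : Fin 3, ((k jj : ℤ) : ℂ) * M jj)) • b k := by
  have h₁ : ∀ j p, Summable fun m => b m j * (dsym j (k - m) * (b + (Pi.single (0 : (Fin 3 → ℤ)) M : (Fin 3 → ℤ) →
      (EuclideanSpace ℂ (Fin 3))) : (Fin 3 → ℤ) → (EuclideanSpace ℂ (Fin 3))) (k - m) p) := by
    intro j p
    have hs := (h j p).add (summable_nl_single_right b M k j p)
    convert hs using 1
    funext m
    simp only [Pi.add_apply, PiLp.add_apply]
    ring
  rw [nl_add_left _ _ _ k h₁ (summable_nl_single_left M _ k),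
    nl_add_right _ _ _ k h (summable_nl_single_right b M k), nl_single_right, add_zero, nl_single_left,
    Pi.add_apply, smul_add]
  have hz : (2 * Real.pi * Complex.I * (∑ jj : Fin 3, ((k jj : ℤ) : ℂ) * M jj)) • (Pi.single (0 : (Fin 3 → ℤ)) M :
      (Fin 3 → ℤ) → (EuclideanSpace ℂ (Fin 3))) k = 0 := by
    by_cases hk : k = 0
    · subst hk; simp
    · rw [Pi.single_eq_of_ne hk, smul_zero]
  rw [hz, add_zero]

/-- **The projected linearised symbol against `δ₀ M` is the drift multiplier**:
`Π_k (N(δ₀M, x̌) + N(x̌, δ₀M))(k) = 2πi (k·M) x̌(k)` for transversal `x`. [folklore] -/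
theorem leray_nl_linearised_single (M : (EuclideanSpace ℂ (Fin 3))) {x : (Fin 3 → ℤ) → (EuclideanSpace ℂ (Fin 3))}
    (hxt : ∀ k : (Fin 3 → ℤ), (∑ jj : Fin 3, ((k jj : ℤ) : ℂ) * (x k) jj) = 0) (k : (Fin 3 → ℤ)) :
    Torus.lerayCoeff k ((WithLp.toLp 2 (fun pp : Fin 3 => transportSym (fun jj mm => (Pi.single (0 : (Fin 3 → ℤ)) M :
        (Fin 3 → ℤ) → (EuclideanSpace ℂ (Fin 3))) mm jj) (fun mm => (((fun mm : Fin 3 → ℤ => (((freqNormSq mm)⁻¹ :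
        ℝ) : ℂ)) • (x : (Fin 3 → ℤ) → EuclideanSpace ℂ (Fin 3)))) mm pp) k) : EuclideanSpace ℂ (Fin 3)) + (WithLp.toLp
        2 (fun pp : Fin 3 => transportSym (fun jj mm => (((fun mm : Fin 3 → ℤ => (((freqNormSq mm)⁻¹ : ℝ) : ℂ)) • (x :
        (Fin 3 → ℤ) → EuclideanSpace ℂ (Fin 3)))) mm jj) (fun mm => (Pi.single (0 : (Fin 3 → ℤ)) M : (Fin 3 → ℤ) →
        (EuclideanSpace ℂ (Fin 3))) mm pp) k) : EuclideanSpace ℂ (Fin 3))) =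
      (2 * Real.pi * Complex.I * (∑ jj : Fin 3, ((k jj : ℤ) : ℂ) * M jj)) • (((fun mm : Fin 3 → ℤ => (((freqNormSq
          mm)⁻¹ : ℝ) : ℂ)) • (x : (Fin 3 → ℤ) → EuclideanSpace ℂ (Fin 3)))) k := by
  rw [nl_single_left, nl_single_right, add_zero, lerayCoeff_smul', lerayCoeff_cf hxt]

/-- **The projected linearised symbol at a full family `a` splits into its punctured part and the
drift of the zero mode**: `Π(N(a, x̌) + N(x̌, a)) = Π N(a°, x̌) + Π N(x̌, a°) + 2πi (k·a(0)) x̌(k)`. [folklore] -/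
theorem leray_nl_linearised_update {a : (Fin 3 → ℤ) → (EuclideanSpace ℂ (Fin 3))} (ha : RapidDecay a) (x : (lp (fun
    _ : Fin 3 → ℤ => EuclideanSpace ℂ (Fin 3)) 2))
    (hxt : ∀ k : (Fin 3 → ℤ), (∑ jj : Fin 3, ((k jj : ℤ) : ℂ) * ((x : (Fin 3 → ℤ) → (EuclideanSpace ℂ (Fin 3))) k) jj)
        = 0) (k : (Fin 3 → ℤ)) :
    Torus.lerayCoeff k ((WithLp.toLp 2 (fun pp : Fin 3 => transportSym (fun jj mm => a mm jj) (fun mm => (((fun mm :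
        Fin 3 → ℤ => (((freqNormSq mm)⁻¹ : ℝ) : ℂ)) • ((x : (Fin 3 → ℤ) → (EuclideanSpace ℂ (Fin 3))) : (Fin 3 → ℤ) →
        EuclideanSpace ℂ (Fin 3)))) mm pp) k) : EuclideanSpace ℂ (Fin 3)) + (WithLp.toLp 2 (fun pp : Fin
        3 => transportSym (fun jj mm => (((fun mm : Fin 3 → ℤ => (((freqNormSq mm)⁻¹ : ℝ) : ℂ)) • ((x : (Fin 3 → ℤ) →
        (EuclideanSpace ℂ (Fin 3))) : (Fin 3 → ℤ) → EuclideanSpace ℂ (Fin 3)))) mm jj) (fun mm => a mm pp) k) :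
        EuclideanSpace ℂ (Fin 3))) =
      Torus.lerayCoeff k ((WithLp.toLp 2 (fun pp : Fin 3 => transportSym (fun jj mm => (Function.update a 0 0) mm jj)
          (fun mm => (((fun mm : Fin 3 → ℤ => (((freqNormSq mm)⁻¹ : ℝ) : ℂ)) • ((x : (Fin 3 → ℤ) → (EuclideanSpace ℂ
          (Fin 3))) : (Fin 3 → ℤ) → EuclideanSpace ℂ (Fin 3)))) mm pp) k) : EuclideanSpace ℂ (Fin 3))) +
        Torus.lerayCoeff k ((WithLp.toLp 2 (fun pp : Fin 3 => transportSym (fun jj mm => (((fun mm : Fin 3 →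
            ℤ => (((freqNormSq mm)⁻¹ : ℝ) : ℂ)) • ((x : (Fin 3 → ℤ) → (EuclideanSpace ℂ (Fin 3))) : (Fin 3 → ℤ) →
            EuclideanSpace ℂ (Fin 3)))) mm jj) (fun mm => (Function.update a 0 0) mm pp) k) : EuclideanSpace ℂ (Fin
            3))) +
        (2 * Real.pi * Complex.I * (∑ jj : Fin 3, ((k jj : ℤ) : ℂ) * (a 0) jj)) • (((fun mm : Fin 3 →
            ℤ => (((freqNormSq mm)⁻¹ : ℝ) : ℂ)) • ((x : (Fin 3 → ℤ) → (EuclideanSpace ℂ (Fin 3))) : (Fin 3 → ℤ) →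
            EuclideanSpace ℂ (Fin 3)))) k := by
  have hb : RapidDecay (Function.update a 0 0) := rapidDecay_update ha
  have hs1 : ∀ j p, Summable fun m => (Function.update a 0 0) m j *
      (dsym j (k - m) * (((fun mm : Fin 3 → ℤ => (((freqNormSq mm)⁻¹ : ℝ) : ℂ)) • ((x : (Fin 3 → ℤ) → (EuclideanSpace
          ℂ (Fin 3))) : (Fin 3 → ℤ) → EuclideanSpace ℂ (Fin 3)))) (k - m) p) :=
    fun j p => summable_nl_term hb.summable_norm (weight_mul_norm_cf_le_norm x) k j p
  have hs2 : ∀ j p, Summable fun m => (((fun mm : Fin 3 → ℤ => (((freqNormSq mm)⁻¹ : ℝ) : ℂ)) • ((x : (Fin 3 → ℤ) →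
      (EuclideanSpace ℂ (Fin 3))) : (Fin 3 → ℤ) → EuclideanSpace ℂ (Fin 3)))) m j *
      (dsym j (k - m) * (Function.update a 0 0) (k - m) p) :=
    fun j p => summable_nl_term (summable_norm_cf x) (weight_mul_norm_le_of_rapidDecay hb) k j p
  conv_lhs => rw [← update_add_single a]
  rw [nl_linearised_add_single (a 0) k hs1 hs2, lerayCoeff_add', lerayCoeff_add', lerayCoeff_smul', lerayCoeff_cf hxt]

/-- **The projected steady symbol at a full transversal family `a` splits into its punctured part
and the drift of the zero mode**: `Π N(a, a)(k) = Π N(a°, a°)(k) + 2πi (k·a(0)) a°(k)`. [folklore] -/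
theorem leray_nl_self_update {a : (Fin 3 → ℤ) → (EuclideanSpace ℂ (Fin 3))} (ha : RapidDecay a) (hat : ∀ m : (Fin 3 →
    ℤ), (∑ jj : Fin 3, ((m jj : ℤ) : ℂ) * (a m) jj) = 0) (k : (Fin 3 → ℤ)) :
    Torus.lerayCoeff k ((WithLp.toLp 2 (fun pp : Fin 3 => transportSym (fun jj mm => a mm jj) (fun mm => a mm pp) k) :
        EuclideanSpace ℂ (Fin 3))) =
      Torus.lerayCoeff k ((WithLp.toLp 2 (fun pp : Fin 3 => transportSym (fun jj mm => (Function.update a 0 0) mm jj)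
          (fun mm => (Function.update a 0 0) mm pp) k) : EuclideanSpace ℂ (Fin 3))) +
        (2 * Real.pi * Complex.I * (∑ jj : Fin 3, ((k jj : ℤ) : ℂ) * (a 0) jj)) • Function.update a 0 0 k := by
  have hb : RapidDecay (Function.update a 0 0) := rapidDecay_update ha
  conv_lhs => rw [← update_add_single a]
  rw [nl_add_single_self (a 0) k (fun j p => summable_nl_rapid hb hb k j p), lerayCoeff_add', lerayCoeff_smul',
    lerayCoeff_update hat]

end Single

/-! ## §B The drift multiplier on the state space `W` -/

section Drift

/-- **Weighted pointwise bound of the drift multiplier** (it gains one weight):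
`⟨k⟩ ‖2πi (k·M) x̌(k)‖ ≤ 12π ‖M‖ ‖x k‖`. [folklore] -/
theorem weight_mul_norm_drift_le (M : (EuclideanSpace ℂ (Fin 3))) (x : (Fin 3 → ℤ) → (EuclideanSpace ℂ (Fin 3))) (k :
    (Fin 3 → ℤ)) :
    sobolevWeight 1 k * ‖(2 * Real.pi * Complex.I * (∑ jj : Fin 3, ((k jj : ℤ) : ℂ) * M jj)) • (((fun mm : Fin 3 →
        ℤ => (((freqNormSq mm)⁻¹ : ℝ) : ℂ)) • (x : (Fin 3 → ℤ) → EuclideanSpace ℂ (Fin 3)))) k‖ ≤ 12 * Real.pi * ‖M‖ *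
        ‖x k‖ := by
  rw [norm_smul]
  calc sobolevWeight 1 k * (‖(2 * Real.pi * Complex.I * (∑ jj : Fin 3, ((k jj : ℤ) : ℂ) * M jj) : ℂ)‖ * ‖(((fun mm :
          Fin 3 → ℤ => (((freqNormSq mm)⁻¹ : ℝ) : ℂ)) • (x : (Fin 3 → ℤ) → EuclideanSpace ℂ (Fin 3)))) k‖)
      ≤ sobolevWeight 1 k * ((2 * Real.pi * (3 * sobolevWeight 1 k * ‖M‖)) * ‖(((fun mm : Fin 3 → ℤ => (((freqNormSq
          mm)⁻¹ : ℝ) : ℂ)) • (x : (Fin 3 → ℤ) → EuclideanSpace ℂ (Fin 3)))) k‖) :=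
        mul_le_mul_of_nonneg_left (mul_le_mul_of_nonneg_right (norm_driftCoeff_le M k) (norm_nonneg _))
          (sobolevWeight_pos 1 k).le
    _ = 6 * Real.pi * ‖M‖ * (sobolevWeight 1 k ^ 2 * ‖(((fun mm : Fin 3 → ℤ => (((freqNormSq mm)⁻¹ : ℝ) : ℂ)) • (x :
        (Fin 3 → ℤ) → EuclideanSpace ℂ (Fin 3)))) k‖) := by ring
    _ ≤ 6 * Real.pi * ‖M‖ * (2 * ‖x k‖) :=
        mul_le_mul_of_nonneg_left (weight_sq_mul_norm_cf_le x k) (by positivity)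
    _ = 12 * Real.pi * ‖M‖ * ‖x k‖ := by ring

/-- Pointwise bound of the drift multiplier: `‖2πi (k·M) x̌(k)‖ ≤ 12π ‖M‖ ‖x k‖`. [folklore] -/
theorem norm_drift_le (M : (EuclideanSpace ℂ (Fin 3))) (x : (Fin 3 → ℤ) → (EuclideanSpace ℂ (Fin 3))) (k : (Fin 3 →
    ℤ)) :
    ‖(2 * Real.pi * Complex.I * (∑ jj : Fin 3, ((k jj : ℤ) : ℂ) * M jj)) • (((fun mm : Fin 3 → ℤ => (((freqNormSq
        mm)⁻¹ : ℝ) : ℂ)) • (x : (Fin 3 → ℤ) → EuclideanSpace ℂ (Fin 3)))) k‖ ≤ 12 * Real.pi * ‖M‖ * ‖x k‖ :=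
  (le_mul_of_one_le_left (norm_nonneg _) (Torus.one_le_sobolevWeight zero_le_one k)).trans
    (weight_mul_norm_drift_le M x k)

variable {W : Submodule ℝ (lp (fun _ : Fin 3 → ℤ => EuclideanSpace ℂ (Fin 3)) 2)} (hW : ∀ x : (lp (fun _ : Fin 3 →
    ℤ => EuclideanSpace ℂ (Fin 3)) 2), x ∈ W ↔ (((x : (Fin 3 → ℤ) → (EuclideanSpace ℂ (Fin 3))) : (Fin 3 → ℤ) →
    EuclideanSpace ℂ (Fin 3)) 0 = 0 ∧ (∀ kk : Fin 3 → ℤ, (∑ jj : Fin 3, ((kk jj : ℤ) : ℂ) * (((x : (Fin 3 → ℤ) →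
    (EuclideanSpace ℂ (Fin 3))) : (Fin 3 → ℤ) → EuclideanSpace ℂ (Fin 3)) kk) jj) = 0) ∧ IsConjSymm ((x : (Fin 3 → ℤ)
    → (EuclideanSpace ℂ (Fin 3))) : (Fin 3 → ℤ) → EuclideanSpace ℂ (Fin 3))))
include hW

/-- **The drift multiplier exists on `W` and is compact**: for a real vector `M` (`conj M = M`)
there is a continuous linear `D : W → W` with `(D x)(k) = 2πi (k·M) x̌(k)` — zero mode `0`,
transversal, conjugate symmetric — mapping the unit ball into an `H¹`-bounded, hence compact, set
(`SteadyLattice.isCompact_eNormSq_one_le`). [folklore] -/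
theorem exists_drift (hWc : IsClosed (W : Set (lp (fun _ : Fin 3 → ℤ => EuclideanSpace ℂ (Fin 3)) 2))) {M :
    (EuclideanSpace ℂ (Fin 3))} (hM : conjVec M = M) :
    ∃ D : W →L[ℝ] W, (∀ x : W, (((D x : W) : (lp (fun _ : Fin 3 → ℤ => EuclideanSpace ℂ (Fin 3)) 2)) : (Fin 3 → ℤ) →
        (EuclideanSpace ℂ (Fin 3))) = fun k =>
      (2 * Real.pi * Complex.I * (∑ jj : Fin 3, ((k jj : ℤ) : ℂ) * M jj)) • (((fun mm : Fin 3 → ℤ => (((freqNormSq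
          mm)⁻¹ : ℝ) : ℂ)) • (((x : (lp (fun _ : Fin 3 → ℤ => EuclideanSpace ℂ (Fin 3)) 2)) : (Fin 3 → ℤ) →
          (EuclideanSpace ℂ (Fin 3))) : (Fin 3 → ℤ) → EuclideanSpace ℂ (Fin 3)))) k) ∧ IsCompactOperator D := by
  set g : (lp (fun _ : Fin 3 → ℤ => EuclideanSpace ℂ (Fin 3)) 2) → (Fin 3 → ℤ) → (EuclideanSpace ℂ (Fin 3)) := fun x
      k => (2 * Real.pi * Complex.I * (∑ jj : Fin 3, ((k jj : ℤ) : ℂ) * M jj)) • (((fun mm : Fin 3 →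
      ℤ => (((freqNormSq mm)⁻¹ : ℝ) : ℂ)) • ((x : (Fin 3 → ℤ) → (EuclideanSpace ℂ (Fin 3))) : (Fin 3 → ℤ) →
      EuclideanSpace ℂ (Fin 3)))) k with hg
  set C : ℝ := 12 * Real.pi * ‖M‖ with hC
  have hC0 : 0 ≤ C := by positivity
  have hbound : ∀ x : (lp (fun _ : Fin 3 → ℤ => EuclideanSpace ℂ (Fin 3)) 2), ∑' k, ‖g x k‖ₑ ^ 2 ≤ (ENNReal.ofReal C *
      ‖x‖ₑ) ^ 2 := by
    intro x
    calc ∑' k, ‖g x k‖ₑ ^ 2 ≤ ∑' k, (ENNReal.ofReal C * ‖(x : (Fin 3 → ℤ) → (EuclideanSpace ℂ (Fin 3))) k‖ₑ) ^ 2 :=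
          ENNReal.tsum_le_tsum fun k => by
            refine pow_le_pow_left' ?_ 2
            rw [← ofReal_norm, ← ofReal_norm, ← ENNReal.ofReal_mul hC0]
            exact ENNReal.ofReal_le_ofReal (norm_drift_le M _ k)
      _ = ENNReal.ofReal C ^ 2 * ∑' k, ‖(x : (Fin 3 → ℤ) → (EuclideanSpace ℂ (Fin 3))) k‖ₑ ^ 2 := by
          rw [← ENNReal.tsum_mul_left]; exact tsum_congr fun k => by ring
      _ = (ENNReal.ofReal C * ‖x‖ₑ) ^ 2 := by rw [← l2_enorm_sq_eq_tsum, mul_pow]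
  have hmem : ∀ x : (lp (fun _ : Fin 3 → ℤ => EuclideanSpace ℂ (Fin 3)) 2), Memℓp (g x) 2 := fun x =>
    memℓp_two_of_tsum_ne_top (ne_top_of_le_ne_top
      (ENNReal.pow_ne_top (ENNReal.mul_ne_top ENNReal.ofReal_ne_top enorm_ne_top)) (hbound x))
  have hV : ∀ x : W, (((g (x : (lp (fun _ : Fin 3 → ℤ => EuclideanSpace ℂ (Fin 3)) 2))) : (Fin 3 → ℤ) → EuclideanSpace
      ℂ (Fin 3)) 0 = 0 ∧ (∀ kk : Fin 3 → ℤ, (∑ jj : Fin 3, ((kk jj : ℤ) : ℂ) * (((g (x : (lp (fun _ : Fin 3 →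
      ℤ => EuclideanSpace ℂ (Fin 3)) 2))) : (Fin 3 → ℤ) → EuclideanSpace ℂ (Fin 3)) kk) jj) = 0) ∧ IsConjSymm ((g (x :
      (lp (fun _ : Fin 3 → ℤ => EuclideanSpace ℂ (Fin 3)) 2))) : (Fin 3 → ℤ) → EuclideanSpace ℂ (Fin 3))) := by
    intro x
    refine ⟨?_, fun k => ?_, fun k => ?_⟩
    · simp only [hg]
      rw [cf_zero, smul_zero]
    · simp only [hg]
      rw [kdot_smul, cf_transversal (W_trans hW x) k, mul_zero]
    · simp only [hg]
      rw [driftCoeff_neg k hM, isConjSymm_cf (W_conj hW x) k, conjVec_smul]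
  set T : W → W := fun x => ⟨⟨g (x : (lp (fun _ : Fin 3 → ℤ => EuclideanSpace ℂ (Fin 3)) 2)), hmem _⟩, (hW _).2 (hV
      x)⟩ with hT
  have hTcoe : ∀ x : W, (((T x : W) : (lp (fun _ : Fin 3 → ℤ => EuclideanSpace ℂ (Fin 3)) 2)) : (Fin 3 → ℤ) →
      (EuclideanSpace ℂ (Fin 3))) = g (x : (lp (fun _ : Fin 3 → ℤ => EuclideanSpace ℂ (Fin 3)) 2)) := fun x => rfl
  have hadd : ∀ x y : W, T (x + y) = T x + T y := by
    intro x y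
    refine Subtype.ext (lp.ext (funext fun k => ?_))
    change g ((x + y : W) : (lp (fun _ : Fin 3 → ℤ => EuclideanSpace ℂ (Fin 3)) 2)) k = g (x : (lp (fun _ : Fin 3 →
        ℤ => EuclideanSpace ℂ (Fin 3)) 2)) k + g (y : (lp (fun _ : Fin 3 → ℤ => EuclideanSpace ℂ (Fin 3)) 2)) k
    simp only [hg]
    rw [show (((x + y : W) : (lp (fun _ : Fin 3 → ℤ => EuclideanSpace ℂ (Fin 3)) 2)) : (Fin 3 → ℤ) → (EuclideanSpace ℂ
        (Fin 3))) = ((x : (lp (fun _ : Fin 3 → ℤ => EuclideanSpace ℂ (Fin 3)) 2)) : (Fin 3 → ℤ) → (EuclideanSpace ℂ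
        (Fin 3))) + ((y : (lp (fun _ : Fin 3 → ℤ => EuclideanSpace ℂ (Fin 3)) 2)) : (Fin 3 → ℤ) → (EuclideanSpace ℂ
        (Fin 3))) from rfl, cf_add,
      Pi.add_apply, smul_add]
  have hsmul : ∀ (a : ℝ) (x : W), T (a • x) = a • T x := by
    intro a x
    refine Subtype.ext (lp.ext (funext fun k => ?_))
    change g ((a • x : W) : (lp (fun _ : Fin 3 → ℤ => EuclideanSpace ℂ (Fin 3)) 2)) k = (a • g (x : (lp (fun _ : Fin 3
        → ℤ => EuclideanSpace ℂ (Fin 3)) 2))) k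
    simp only [hg, Pi.smul_apply]
    rw [show (((a • x : W) : (lp (fun _ : Fin 3 → ℤ => EuclideanSpace ℂ (Fin 3)) 2)) : (Fin 3 → ℤ) → (EuclideanSpace ℂ
        (Fin 3))) = a • ((x : (lp (fun _ : Fin 3 → ℤ => EuclideanSpace ℂ (Fin 3)) 2)) : (Fin 3 → ℤ) → (EuclideanSpace
        ℂ (Fin 3))) from rfl, cf_real_smul, Pi.smul_apply,
      smul_comm, Complex.coe_smul]
  have hnorm : ∀ x : W, ‖T x‖ ≤ C * ‖x‖ := by
    intro x
    rw [← norm_coeW]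
    refine l2_norm_le_of_tsum_le _ (by positivity) ?_
    rw [hTcoe, ENNReal.ofReal_mul hC0, ofReal_norm]
    exact hbound _
  set Dl : W →ₗ[ℝ] W := { toFun := T, map_add' := hadd, map_smul' := hsmul } with hDl
  refine ⟨Dl.mkContinuous C hnorm, fun x => rfl, ?_⟩
  -- compactness: the image of the unit ball is `H¹`-bounded
  refine (isCompactOperator_iff_image_closedBall_subset_compact ((Dl.mkContinuous C hnorm : W →L[ℝ] W) : W →ₗ[ℝ] W)
    zero_lt_one).2 ⟨{z : W | Lattice.eNormSq 1 ((z : (lp (fun _ : Fin 3 → ℤ => EuclideanSpace ℂ (Fin 3)) 2)) : (Fin 3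
        → ℤ) → (EuclideanSpace ℂ (Fin 3))) ≤ ENNReal.ofReal C ^ 2},
      isCompact_eNormSq_one_le hWc (ENNReal.pow_ne_top ENNReal.ofReal_ne_top), ?_⟩
  rintro _ ⟨w, hw, rfl⟩
  rw [Metric.mem_closedBall, dist_zero_right] at hw
  change Lattice.eNormSq 1 (g (w : (lp (fun _ : Fin 3 → ℤ => EuclideanSpace ℂ (Fin 3)) 2))) ≤ ENNReal.ofReal C ^ 2
  have hw' : ‖(w : (lp (fun _ : Fin 3 → ℤ => EuclideanSpace ℂ (Fin 3)) 2))‖ₑ ≤ 1 := by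
    rw [← ofReal_norm, ← ENNReal.ofReal_one]
    exact ENNReal.ofReal_le_ofReal hw
  unfold Lattice.eNormSq
  calc ∑' k, ENNReal.ofReal (sobolevWeight 1 k ^ 2) * ‖g (w : (lp (fun _ : Fin 3 → ℤ => EuclideanSpace ℂ (Fin 3)) 2))
          k‖ₑ ^ 2
      ≤ ∑' k, (ENNReal.ofReal C * ‖((w : (lp (fun _ : Fin 3 → ℤ => EuclideanSpace ℂ (Fin 3)) 2)) : (Fin 3 → ℤ) →
          (EuclideanSpace ℂ (Fin 3))) k‖ₑ) ^ 2 := ENNReal.tsum_le_tsum fun k => by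
        rw [ENNReal.ofReal_pow (sobolevWeight_pos 1 k).le, ← mul_pow]
        refine pow_le_pow_left' ?_ 2
        rw [← ofReal_norm, ← ofReal_norm, ← ENNReal.ofReal_mul (sobolevWeight_pos 1 k).le, ← ENNReal.ofReal_mul hC0]
        exact ENNReal.ofReal_le_ofReal (weight_mul_norm_drift_le M _ k)
    _ = ENNReal.ofReal C ^ 2 * ‖(w : (lp (fun _ : Fin 3 → ℤ => EuclideanSpace ℂ (Fin 3)) 2))‖ₑ ^ 2 := by
        rw [l2_enorm_sq_eq_tsum, ← ENNReal.tsum_mul_left]; exact tsum_congr fun k => by ring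
    _ ≤ ENNReal.ofReal C ^ 2 * 1 ^ 2 := mul_le_mul_right (pow_le_pow_left' hw' 2) _
    _ = ENNReal.ofReal C ^ 2 := by rw [one_pow, mul_one]

end Drift

/-! ## §C Elliptic regularity on the lattice for the perturbed steady equation -/

section Regularity

/-- **Regularity of `H²` solutions of the perturbed steady lattice equation**: for rapidly decaying
transversal `a`, `x ∈ ℓ²` transversal, and `F` with all weighted `ℓ¹` bounds, a solution of
`4π²ν x(k) + Π_k (N(a, x̌) + N(x̌, a))(k) + Π_k N(x̌, x̌)(k) = F(k)` has rapidly decaying `x̌ = cf x`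
(the bootstrap `SteadyNS.tsum_weight_mul_ne_top` applied to `‖a‖ + ‖x̌‖` with forcing
`‖F‖ + ⟨·⟩₂‖a‖`; with `a = δ₀ m` this is the drifted steady equation, with `a = 0` the steady one,
with `F = 0`, `N(x̌,x̌)` dropped the linearised one). [folklore] -/
theorem rapidDecay_of_perturbed_eq {ν : ℝ} (hν : 0 < ν) {a : (Fin 3 → ℤ) → (EuclideanSpace ℂ (Fin 3))} (ha :
    RapidDecay a)
    (hat : ∀ m : (Fin 3 → ℤ), (∑ jj : Fin 3, ((m jj : ℤ) : ℂ) * (a m) jj) = 0) (x : (lp (fun _ : Fin 3 →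
        ℤ => EuclideanSpace ℂ (Fin 3)) 2)) (hxt : ∀ k : (Fin 3 → ℤ), (∑ jj : Fin 3, ((k jj : ℤ) : ℂ) * ((x : (Fin 3 →
        ℤ) → (EuclideanSpace ℂ (Fin 3))) k) jj) = 0)
    {F : (Fin 3 → ℤ) → (EuclideanSpace ℂ (Fin 3))} (hF : ∀ s : ℝ, ∑' k, ENNReal.ofReal (sobolevWeight s k) * ‖F k‖ₑ ≠
        ∞)
    (heq : ∀ k : (Fin 3 → ℤ), (((4 * Real.pi ^ 2 * ν : ℝ)) : ℂ) • (x : (Fin 3 → ℤ) → (EuclideanSpace ℂ (Fin 3))) k +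
      Torus.lerayCoeff k ((WithLp.toLp 2 (fun pp : Fin 3 => transportSym (fun jj mm => a mm jj) (fun mm => (((fun mm :
          Fin 3 → ℤ => (((freqNormSq mm)⁻¹ : ℝ) : ℂ)) • ((x : (Fin 3 → ℤ) → (EuclideanSpace ℂ (Fin 3))) : (Fin 3 → ℤ)
          → EuclideanSpace ℂ (Fin 3)))) mm pp) k) : EuclideanSpace ℂ (Fin 3)) + (WithLp.toLp 2 (fun pp : Fin
          3 => transportSym (fun jj mm => (((fun mm : Fin 3 → ℤ => (((freqNormSq mm)⁻¹ : ℝ) : ℂ)) • ((x : (Fin 3 → ℤ)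
          → (EuclideanSpace ℂ (Fin 3))) : (Fin 3 → ℤ) → EuclideanSpace ℂ (Fin 3)))) mm jj) (fun mm => a mm pp) k) :
          EuclideanSpace ℂ (Fin 3))) +
      Torus.lerayCoeff k ((WithLp.toLp 2 (fun pp : Fin 3 => transportSym (fun jj mm => (((fun mm : Fin 3 →
          ℤ => (((freqNormSq mm)⁻¹ : ℝ) : ℂ)) • ((x : (Fin 3 → ℤ) → (EuclideanSpace ℂ (Fin 3))) : (Fin 3 → ℤ) →
          EuclideanSpace ℂ (Fin 3)))) mm jj) (fun mm => (((fun mm : Fin 3 → ℤ => (((freqNormSq mm)⁻¹ : ℝ) : ℂ)) •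
          ((x : (Fin 3 → ℤ) → (EuclideanSpace ℂ (Fin 3))) : (Fin 3 → ℤ) → EuclideanSpace ℂ (Fin 3)))) mm pp) k) :
          EuclideanSpace ℂ (Fin 3))) = F k) :
    RapidDecay (((fun mm : Fin 3 → ℤ => (((freqNormSq mm)⁻¹ : ℝ) : ℂ)) • ((x : (Fin 3 → ℤ) → (EuclideanSpace ℂ (Fin
        3))) : (Fin 3 → ℤ) → EuclideanSpace ℂ (Fin 3)))) := by
  set A : (Fin 3 → ℤ) → ℝ≥0∞ := fun k => ‖a k‖ₑ + ‖(((fun mm : Fin 3 → ℤ => (((freqNormSq mm)⁻¹ : ℝ) : ℂ)) • ((x :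
      (Fin 3 → ℤ) → (EuclideanSpace ℂ (Fin 3))) : (Fin 3 → ℤ) → EuclideanSpace ℂ (Fin 3)))) k‖ₑ with hA
  have hc : 0 < 4 * Real.pi ^ 2 * ν := by positivity
  -- summabilities of the symbols
  have hsa : Summable fun m => ‖a m‖ := ha.summable_norm
  have hs1 : ∀ k j p, Summable fun m => a m j * (dsym j (k - m) * (((fun mm : Fin 3 → ℤ => (((freqNormSq mm)⁻¹ : ℝ) :
      ℂ)) • ((x : (Fin 3 → ℤ) → (EuclideanSpace ℂ (Fin 3))) : (Fin 3 → ℤ) → EuclideanSpace ℂ (Fin 3)))) (k - m) p) :=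
    fun k j p => summable_nl_term hsa (weight_mul_norm_cf_le_norm x) k j p
  have hs2 : ∀ k j p, Summable fun m => (((fun mm : Fin 3 → ℤ => (((freqNormSq mm)⁻¹ : ℝ) : ℂ)) • ((x : (Fin 3 → ℤ) →
      (EuclideanSpace ℂ (Fin 3))) : (Fin 3 → ℤ) → EuclideanSpace ℂ (Fin 3)))) m j * (dsym j (k - m) * a (k - m) p) :=
    fun k j p => summable_nl_term (summable_norm_cf x) (weight_mul_norm_le_of_rapidDecay ha) k j p
  -- the convolution bounds
  have hconvL : ∀ k, ‖Torus.lerayCoeff k ((WithLp.toLp 2 (fun pp : Fin 3 => transportSym (fun jj mm => a mm jj) (fun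
      mm => (((fun mm : Fin 3 → ℤ => (((freqNormSq mm)⁻¹ : ℝ) : ℂ)) • ((x : (Fin 3 → ℤ) → (EuclideanSpace ℂ (Fin
      3))) : (Fin 3 → ℤ) → EuclideanSpace ℂ (Fin 3)))) mm pp) k) : EuclideanSpace ℂ (Fin 3)) + (WithLp.toLp 2 (fun
      pp : Fin 3 => transportSym (fun jj mm => (((fun mm : Fin 3 → ℤ => (((freqNormSq mm)⁻¹ : ℝ) : ℂ)) • ((x : (Fin 3
      → ℤ) → (EuclideanSpace ℂ (Fin 3))) : (Fin 3 → ℤ) → EuclideanSpace ℂ (Fin 3)))) mm jj) (fun mm => a mm pp) k) :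
      EuclideanSpace ℂ (Fin 3)))‖ₑ ≤
      2 * (ENNReal.ofReal (18 * Real.pi) * ENNReal.ofReal (sobolevWeight 1 k) * ∑' l, A (k - l) * A l) := by
    intro k
    refine (enorm_lerayCoeff_le k _).trans ((enorm_add_le _ _).trans ?_)
    rw [two_mul]
    refine add_le_add ?_ ?_
    · refine (enorm_nl_le_of_transversal _ _ k hat (hs1 k)).trans ?_
      refine mul_le_mul_right ?_ _
      calc ∑' m, ‖a m‖ₑ * ‖(((fun mm : Fin 3 → ℤ => (((freqNormSq mm)⁻¹ : ℝ) : ℂ)) • ((x : (Fin 3 → ℤ) →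
              (EuclideanSpace ℂ (Fin 3))) : (Fin 3 → ℤ) → EuclideanSpace ℂ (Fin 3)))) (k - m)‖ₑ ≤ ∑' m, A m * A (k -
              m) :=
            ENNReal.tsum_le_tsum fun m => mul_le_mul' le_self_add le_add_self
        _ = ∑' l, A (k - l) * A l := tsum_congr fun l => mul_comm _ _
    · refine (enorm_nl_le_of_transversal _ _ k (cf_transversal hxt) (hs2 k)).trans ?_
      refine mul_le_mul_right ?_ _
      calc ∑' m, ‖(((fun mm : Fin 3 → ℤ => (((freqNormSq mm)⁻¹ : ℝ) : ℂ)) • ((x : (Fin 3 → ℤ) → (EuclideanSpace ℂ (Fin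
              3))) : (Fin 3 → ℤ) → EuclideanSpace ℂ (Fin 3)))) m‖ₑ * ‖a (k - m)‖ₑ ≤ ∑' m, A m * A (k - m) :=
            ENNReal.tsum_le_tsum fun m => mul_le_mul' le_add_self le_self_add
        _ = ∑' l, A (k - l) * A l := tsum_congr fun l => mul_comm _ _
  have hconvN : ∀ k, ‖Torus.lerayCoeff k ((WithLp.toLp 2 (fun pp : Fin 3 => transportSym (fun jj mm => (((fun mm : Fin
      3 → ℤ => (((freqNormSq mm)⁻¹ : ℝ) : ℂ)) • ((x : (Fin 3 → ℤ) → (EuclideanSpace ℂ (Fin 3))) : (Fin 3 → ℤ) →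
      EuclideanSpace ℂ (Fin 3)))) mm jj) (fun mm => (((fun mm : Fin 3 → ℤ => (((freqNormSq mm)⁻¹ : ℝ) : ℂ)) • ((x :
      (Fin 3 → ℤ) → (EuclideanSpace ℂ (Fin 3))) : (Fin 3 → ℤ) → EuclideanSpace ℂ (Fin 3)))) mm pp) k) : EuclideanSpace
      ℂ (Fin 3)))‖ₑ ≤
      ENNReal.ofReal (18 * Real.pi) * ENNReal.ofReal (sobolevWeight 1 k) * ∑' l, A (k - l) * A l := by
    intro k
    refine (enorm_lerayCoeff_le k _).trans ((enorm_nl_le_of_transversal _ _ k (cf_transversal hxt)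
      (fun j p => summable_nl_cf x x k j p)).trans ?_)
    refine mul_le_mul_right ?_ _
    calc ∑' m, ‖(((fun mm : Fin 3 → ℤ => (((freqNormSq mm)⁻¹ : ℝ) : ℂ)) • ((x : (Fin 3 → ℤ) → (EuclideanSpace ℂ (Fin
            3))) : (Fin 3 → ℤ) → EuclideanSpace ℂ (Fin 3)))) m‖ₑ * ‖(((fun mm : Fin 3 → ℤ => (((freqNormSq mm)⁻¹ :
            ℝ) : ℂ)) • ((x : (Fin 3 → ℤ) → (EuclideanSpace ℂ (Fin 3))) : (Fin 3 → ℤ) → EuclideanSpace ℂ (Fin 3)))) (k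
            - m)‖ₑ ≤ ∑' m, A m * A (k - m) :=
          ENNReal.tsum_le_tsum fun m => mul_le_mul' le_add_self le_add_self
      _ = ∑' l, A (k - l) * A l := tsum_congr fun l => mul_comm _ _
  have hconv : ∀ k, ‖Torus.lerayCoeff k ((WithLp.toLp 2 (fun pp : Fin 3 => transportSym (fun jj mm => a mm jj) (fun
      mm => (((fun mm : Fin 3 → ℤ => (((freqNormSq mm)⁻¹ : ℝ) : ℂ)) • ((x : (Fin 3 → ℤ) → (EuclideanSpace ℂ (Fin
      3))) : (Fin 3 → ℤ) → EuclideanSpace ℂ (Fin 3)))) mm pp) k) : EuclideanSpace ℂ (Fin 3)) + (WithLp.toLp 2 (fun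
      pp : Fin 3 => transportSym (fun jj mm => (((fun mm : Fin 3 → ℤ => (((freqNormSq mm)⁻¹ : ℝ) : ℂ)) • ((x : (Fin 3
      → ℤ) → (EuclideanSpace ℂ (Fin 3))) : (Fin 3 → ℤ) → EuclideanSpace ℂ (Fin 3)))) mm jj) (fun mm => a mm pp) k) :
      EuclideanSpace ℂ (Fin 3)))‖ₑ +
      ‖Torus.lerayCoeff k ((WithLp.toLp 2 (fun pp : Fin 3 => transportSym (fun jj mm => (((fun mm : Fin 3 →
          ℤ => (((freqNormSq mm)⁻¹ : ℝ) : ℂ)) • ((x : (Fin 3 → ℤ) → (EuclideanSpace ℂ (Fin 3))) : (Fin 3 → ℤ) →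
          EuclideanSpace ℂ (Fin 3)))) mm jj) (fun mm => (((fun mm : Fin 3 → ℤ => (((freqNormSq mm)⁻¹ : ℝ) : ℂ)) •
          ((x : (Fin 3 → ℤ) → (EuclideanSpace ℂ (Fin 3))) : (Fin 3 → ℤ) → EuclideanSpace ℂ (Fin 3)))) mm pp) k) :
          EuclideanSpace ℂ (Fin 3)))‖ₑ ≤
      3 * (ENNReal.ofReal (18 * Real.pi) * ENNReal.ofReal (sobolevWeight 1 k) * ∑' l, A (k - l) * A l) := by
    intro k
    calc _ ≤ 2 * (ENNReal.ofReal (18 * Real.pi) * ENNReal.ofReal (sobolevWeight 1 k) * ∑' l, A (k - l) * A l) +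
          (ENNReal.ofReal (18 * Real.pi) * ENNReal.ofReal (sobolevWeight 1 k) * ∑' l, A (k - l) * A l) :=
          add_le_add (hconvL k) (hconvN k)
      _ = _ := by ring
  -- the constant
  set C : ℝ≥0∞ := ENNReal.ofReal (1 + 2 * (4 * Real.pi ^ 2 * ν)⁻¹ * (3 * (18 * Real.pi))) with hC
  have h18 : (1 : ℝ) ≤ 3 * (18 * Real.pi) := by nlinarith [Real.pi_gt_three]
  have hC1 : (1 : ℝ≥0∞) ≤ C := ENNReal.one_le_ofReal.2 (by
    have : (0:ℝ) ≤ 2 * (4 * Real.pi ^ 2 * ν)⁻¹ * (3 * (18 * Real.pi)) := by positivity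
    linarith)
  have hCe : ENNReal.ofReal (2 * (4 * Real.pi ^ 2 * ν)⁻¹ * (3 * (18 * Real.pi))) =
      2 * (ENNReal.ofReal (4 * Real.pi ^ 2 * ν)⁻¹ * (3 * ENNReal.ofReal (18 * Real.pi))) := by
    rw [ENNReal.ofReal_mul (p := 2 * (4 * Real.pi ^ 2 * ν)⁻¹) (by positivity),
      ENNReal.ofReal_mul (p := 2) (by norm_num), ENNReal.ofReal_mul (p := 3) (by norm_num), ENNReal.ofReal_ofNat,
      ENNReal.ofReal_ofNat]
    ring
  have hC2 : 2 * (ENNReal.ofReal (4 * Real.pi ^ 2 * ν)⁻¹ * (3 * ENNReal.ofReal (18 * Real.pi))) ≤ C := by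
    rw [← hCe, hC]
    exact ENNReal.ofReal_le_ofReal (by linarith)
  have hC3 : 2 * ENNReal.ofReal (4 * Real.pi ^ 2 * ν)⁻¹ ≤ C := by
    have e : 2 * ENNReal.ofReal (4 * Real.pi ^ 2 * ν)⁻¹ = ENNReal.ofReal (2 * (4 * Real.pi ^ 2 * ν)⁻¹) := by
      rw [ENNReal.ofReal_mul (by norm_num : (0:ℝ) ≤ 2), ENNReal.ofReal_ofNat]
    rw [e, hC]
    refine ENNReal.ofReal_le_ofReal ?_
    have h0 : (0:ℝ) ≤ 2 * (4 * Real.pi ^ 2 * ν)⁻¹ := by positivity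
    nlinarith
  -- the coefficient inequality with forcing `‖F‖ + ⟨k⟩₂ ‖a k‖`
  have hineq : ∀ k, ENNReal.ofReal (sobolevWeight 2 k) * A k ≤
      C * ((‖F k‖ₑ + ENNReal.ofReal (sobolevWeight 2 k) * ‖a k‖ₑ) +
        ENNReal.ofReal (sobolevWeight 1 k) * ∑' l, A (k - l) * A l) := by
    intro k
    have h1 := weight_two_mul_enorm_cf_le (x : (Fin 3 → ℤ) → (EuclideanSpace ℂ (Fin 3))) k
    have heq' : (((4 * Real.pi ^ 2 * ν : ℝ)) : ℂ) • (x : (Fin 3 → ℤ) → (EuclideanSpace ℂ (Fin 3))) k +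
        (Torus.lerayCoeff k ((WithLp.toLp 2 (fun pp : Fin 3 => transportSym (fun jj mm => a mm jj) (fun mm => (((fun
            mm : Fin 3 → ℤ => (((freqNormSq mm)⁻¹ : ℝ) : ℂ)) • ((x : (Fin 3 → ℤ) → (EuclideanSpace ℂ (Fin 3))) : (Fin
            3 → ℤ) → EuclideanSpace ℂ (Fin 3)))) mm pp) k) : EuclideanSpace ℂ (Fin 3)) + (WithLp.toLp 2 (fun pp : Fin
            3 => transportSym (fun jj mm => (((fun mm : Fin 3 → ℤ => (((freqNormSq mm)⁻¹ : ℝ) : ℂ)) • ((x : (Fin 3 →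
            ℤ) → (EuclideanSpace ℂ (Fin 3))) : (Fin 3 → ℤ) → EuclideanSpace ℂ (Fin 3)))) mm jj) (fun mm => a mm pp)
            k) : EuclideanSpace ℂ (Fin 3))) +
          Torus.lerayCoeff k ((WithLp.toLp 2 (fun pp : Fin 3 => transportSym (fun jj mm => (((fun mm : Fin 3 →
              ℤ => (((freqNormSq mm)⁻¹ : ℝ) : ℂ)) • ((x : (Fin 3 → ℤ) → (EuclideanSpace ℂ (Fin 3))) : (Fin 3 → ℤ) →
              EuclideanSpace ℂ (Fin 3)))) mm jj) (fun mm => (((fun mm : Fin 3 → ℤ => (((freqNormSq mm)⁻¹ : ℝ) : ℂ)) •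
              ((x : (Fin 3 → ℤ) → (EuclideanSpace ℂ (Fin 3))) : (Fin 3 → ℤ) → EuclideanSpace ℂ (Fin 3)))) mm pp) k) :
              EuclideanSpace ℂ (Fin 3)))) = F k := by
      rw [← add_assoc]; exact heq k
    have h2 := (enorm_le_of_smul_add_eq hc heq').trans
      (mul_le_mul_right (add_le_add le_rfl ((enorm_add_le _ _).trans (hconv k))) _)
    calc ENNReal.ofReal (sobolevWeight 2 k) * A k
        = ENNReal.ofReal (sobolevWeight 2 k) * ‖a k‖ₑ +
            ENNReal.ofReal (sobolevWeight 2 k) * ‖(((fun mm : Fin 3 → ℤ => (((freqNormSq mm)⁻¹ : ℝ) : ℂ)) • ((x : (Fin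
                3 → ℤ) → (EuclideanSpace ℂ (Fin 3))) : (Fin 3 → ℤ) → EuclideanSpace ℂ (Fin 3))))
                k‖ₑ := by rw [hA]; ring
      _ ≤ ENNReal.ofReal (sobolevWeight 2 k) * ‖a k‖ₑ + 2 * ‖(x : (Fin 3 → ℤ) → (EuclideanSpace ℂ (Fin 3))) k‖ₑ :=
          add_le_add le_rfl h1
      _ ≤ ENNReal.ofReal (sobolevWeight 2 k) * ‖a k‖ₑ + 2 * (ENNReal.ofReal (4 * Real.pi ^ 2 * ν)⁻¹ *
            (‖F k‖ₑ + 3 * (ENNReal.ofReal (18 * Real.pi) * ENNReal.ofReal (sobolevWeight 1 k) *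
              ∑' l, A (k - l) * A l))) := add_le_add le_rfl (mul_le_mul_right h2 _)
      _ = 1 * (ENNReal.ofReal (sobolevWeight 2 k) * ‖a k‖ₑ) + (2 * ENNReal.ofReal (4 * Real.pi ^ 2 * ν)⁻¹) * ‖F k‖ₑ +
            (2 * (ENNReal.ofReal (4 * Real.pi ^ 2 * ν)⁻¹ * (3 * ENNReal.ofReal (18 * Real.pi)))) *
            (ENNReal.ofReal (sobolevWeight 1 k) * ∑' l, A (k - l) * A l) := by ring
      _ ≤ C * (ENNReal.ofReal (sobolevWeight 2 k) * ‖a k‖ₑ) + C * ‖F k‖ₑ +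
            C * (ENNReal.ofReal (sobolevWeight 1 k) * ∑' l, A (k - l) * A l) :=
          add_le_add (add_le_add (mul_le_mul_left hC1 _) (mul_le_mul_left hC3 _)) (mul_le_mul_left hC2 _)
      _ = C * ((‖F k‖ₑ + ENNReal.ofReal (sobolevWeight 2 k) * ‖a k‖ₑ) +
            ENNReal.ofReal (sobolevWeight 1 k) * ∑' l, A (k - l) * A l) := by ring
  have hF' : ∀ s : ℝ, ∑' k, ENNReal.ofReal (sobolevWeight s k) *
      (‖F k‖ₑ + ENNReal.ofReal (sobolevWeight 2 k) * ‖a k‖ₑ) ≠ ∞ := by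
    intro s
    have h := tsum_weight_mul_enorm_ne_top_of_rapidDecay ha (s + 2)
    have h2 : ∑' k, ENNReal.ofReal (sobolevWeight s k) * (ENNReal.ofReal (sobolevWeight 2 k) * ‖a k‖ₑ) ≠ ∞ := by
      refine fun htop => h ?_
      rw [← htop]
      refine tsum_congr fun k => ?_
      rw [← mul_assoc, SteadyNS.ofReal_sobolevWeight_mul]
    simp_rw [mul_add]
    rw [ENNReal.tsum_add]
    exact ENNReal.add_ne_top.2 ⟨hF s, h2⟩
  -- the `H¹` bound for `A`
  have hA2 : ∑' k, ENNReal.ofReal (sobolevWeight 2 k) * A k ^ (2 : ℝ) ≠ ∞ := by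
    have hSa : ∑' m, ‖a m‖ₑ ≠ ∞ := by
      have := tsum_weight_mul_enorm_ne_top_of_rapidDecay ha 0
      simpa only [sobolevWeight_zero, ENNReal.ofReal_one, one_mul] using this
    have hWa : ∑' k, ENNReal.ofReal (sobolevWeight 2 k) * ‖a k‖ₑ ≠ ∞ :=
      tsum_weight_mul_enorm_ne_top_of_rapidDecay ha 2
    have hle : ∀ k, ENNReal.ofReal (sobolevWeight 2 k) * A k ^ (2 : ℝ) ≤
        2 * ((∑' m, ‖a m‖ₑ) * (ENNReal.ofReal (sobolevWeight 2 k) * ‖a k‖ₑ)) +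
        2 * (ENNReal.ofReal (sobolevWeight 2 k) * ‖(((fun mm : Fin 3 → ℤ => (((freqNormSq mm)⁻¹ : ℝ) : ℂ)) • ((x :
            (Fin 3 → ℤ) → (EuclideanSpace ℂ (Fin 3))) : (Fin 3 → ℤ) → EuclideanSpace ℂ (Fin 3)))) k‖ₑ ^ (2 : ℝ)) := by
      intro k
      rw [ENNReal.rpow_two, ENNReal.rpow_two]
      have hak : ‖a k‖ₑ ≤ ∑' m, ‖a m‖ₑ := ENNReal.le_tsum k
      calc ENNReal.ofReal (sobolevWeight 2 k) * A k ^ 2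
          ≤ ENNReal.ofReal (sobolevWeight 2 k) * (2 * ‖a k‖ₑ ^ 2 + 2 * ‖(((fun mm : Fin 3 → ℤ => (((freqNormSq mm)⁻¹ :
              ℝ) : ℂ)) • ((x : (Fin 3 → ℤ) → (EuclideanSpace ℂ (Fin 3))) : (Fin 3 → ℤ) → EuclideanSpace ℂ (Fin 3))))
              k‖ₑ ^ 2) :=
            mul_le_mul_right (Lattice.ennreal_add_pow_two_le _ _) _
        _ = 2 * (‖a k‖ₑ * (ENNReal.ofReal (sobolevWeight 2 k) * ‖a k‖ₑ)) +
            2 * (ENNReal.ofReal (sobolevWeight 2 k) * ‖(((fun mm : Fin 3 → ℤ => (((freqNormSq mm)⁻¹ : ℝ) : ℂ)) • ((x :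
                (Fin 3 → ℤ) → (EuclideanSpace ℂ (Fin 3))) : (Fin 3 → ℤ) → EuclideanSpace ℂ (Fin 3)))) k‖ₑ ^
                2) := by ring
        _ ≤ _ := add_le_add (mul_le_mul_right (mul_le_mul_left hak _) _) le_rfl
    refine ne_top_of_le_ne_top ?_ (ENNReal.tsum_le_tsum hle)
    rw [ENNReal.tsum_add, ENNReal.tsum_mul_left, ENNReal.tsum_mul_left, ENNReal.tsum_mul_left]
    exact ENNReal.add_ne_top.2 ⟨ENNReal.mul_ne_top (by simp) (ENNReal.mul_ne_top hSa hWa),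
      ENNReal.mul_ne_top (by simp) (tsum_weight_two_mul_enorm_cf_sq_ne_top x)⟩
  have hCtop : C ≠ ∞ := ENNReal.ofReal_ne_top
  have hfin := SteadyNS.tsum_weight_mul_ne_top (A := A)
    (F := fun k => ‖F k‖ₑ + ENNReal.ofReal (sobolevWeight 2 k) * ‖a k‖ₑ) hCtop hF' hineq (by simp) hA2
  refine SteadyNS.rapidDecay_of_tsum_weight_mul_enorm_ne_top fun m => ?_
  exact ne_top_of_le_ne_top (hfin m) (ENNReal.tsum_le_tsum fun k => mul_le_mul_right le_add_self _)

end Regularity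

/-! ## §D The dictionary without mean conditions -/

section Dictionary

/-- **A classical steady state of any mean solves the projected steady equations on the lattice**
for its full coefficient family `û` (zero mode `û(0) = ⨍ u` included; the drift `(m·∇)v` sits
inside `N(û, û)`): `ν4π²|k|² û(k) + Π_k N(û,û)(k) = Π_k f̂(k)` for every `k`. [folklore] -/
theorem fourier_eq_of_isSteadyNSState' {ν : ℝ} {f u : (UnitAddTorus (Fin 3)) → (EuclideanSpace ℝ (Fin 3))} {p :
    (UnitAddTorus (Fin 3)) → ℝ} (h : Torus.IsSteadyNSState ν f u p)
    (hf : IsSmooth f) (k : (Fin 3 → ℤ)) :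
    (((ν * (4 * Real.pi ^ 2 * freqNormSq k)) : ℝ) : ℂ) • mFourierCoeff (complexify ∘ u) k +
      Torus.lerayCoeff k ((WithLp.toLp 2 (fun pp : Fin 3 => transportSym (fun jj mm => (mFourierCoeff (complexify
          ∘ u)) mm jj) (fun mm => (mFourierCoeff (complexify ∘ u)) mm pp) k) : EuclideanSpace ℂ (Fin 3))) =
      Torus.lerayCoeff k (mFourierCoeff (complexify ∘ f) k) := by
  have hu : IsSmooth u := h.smooth_velocity.isSmooth_slice (Set.mem_univ 0)
  have hp : IsSmooth p := h.smooth_pressure.isSmooth_slice (Set.mem_univ 0)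
  have hdiv : IsDivFree u := h.divFree 0 (Set.mem_univ 0)
  -- the residual vanishes identically
  have hres : (fun y => complexify (Torus.convect u u y) - (ν : ℂ) • complexify (laplacian u y) +
      Torus.gradientC (fun z => ((p z : ℝ) : ℂ)) y - complexify (f y)) = 0 := by
    funext y
    have hm := h.momentum 0 (Set.mem_univ 0) y
    have ht : Torus.timeDerivWithin Set.univ (fun _ : ℝ => u) 0 y = 0 := by simp [Torus.timeDerivWithin]
    simp only [ht, zero_add] at hm
    rw [gradientC_ofReal hp, Pi.zero_apply, coe_smul_complexify, hm, ← map_sub, ← map_add, ← map_sub,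
      show ν • laplacian u y - Torus.gradient p y + f y - ν • laplacian u y + Torus.gradient p y - f y = 0 by abel,
      map_zero]
  have hk := mFourierCoeff_steadyResidual (ν := ν) (P := fun z => ((p z : ℝ) : ℂ)) hu hf hp.ofReal k
  rw [hres] at hk
  have hzero : mFourierCoeff (0 : (UnitAddTorus (Fin 3)) → (EuclideanSpace ℂ (Fin 3))) k = 0 := by
    rw [show (0 : (UnitAddTorus (Fin 3)) → (EuclideanSpace ℂ (Fin 3))) = (0 : ℂ) • (0 : (UnitAddTorus (Fin 3)) →
        (EuclideanSpace ℂ (Fin 3))) by simp, mFourierCoeff_const_smul, zero_smul]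
  rw [hzero] at hk
  -- apply the Leray multiplier
  by_cases hk0 : k = 0
  · subst hk0
    have hn0 : (WithLp.toLp 2 (fun pp : Fin 3 => transportSym (fun jj mm => (mFourierCoeff (complexify ∘ u)) mm jj)
        (fun mm => (mFourierCoeff (complexify ∘ u)) mm pp) 0) : EuclideanSpace ℂ (Fin 3)) = 0 :=
      nl_zero_of_transversal _ _ (fun m => hdiv.sum_mul_mFourierCoeff_eq_zero hu m)
        (fun j p => summable_nl_rapid hu.complexify_comp.rapidDecay_mFourierCoeff
          hu.complexify_comp.rapidDecay_mFourierCoeff 0 j p)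
    rw [hn0, Torus.lerayCoeff_zero, Torus.lerayCoeff_zero, freqNormSq_zero]
    simp
  · have htr : (∑ jj : Fin 3, ((k jj : ℤ) : ℂ) * (mFourierCoeff (complexify ∘ u) k) jj) = 0 :=
      hdiv.sum_mul_mFourierCoeff_eq_zero hu k
    have e1 := lerayCoeff_of_kdot_eq_zero hk0 htr
    have h' := congrArg (Torus.lerayCoeff k) hk
    rw [lerayCoeff_zero_vec, lerayCoeff_sub', lerayCoeff_add', lerayCoeff_add', lerayCoeff_smul', lerayCoeff_smul',
      e1, lerayCoeff_freqVec, smul_zero, add_zero] at h'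
    rw [add_comm]
    exact sub_eq_zero.1 h'.symm

/-- The zero Fourier mode of a smooth real field is its complexified space average. [folklore] -/
theorem mFourierCoeff_complexify_zero {u : (UnitAddTorus (Fin 3)) → (EuclideanSpace ℝ (Fin 3))} (hu : IsSmooth u) :
    mFourierCoeff (complexify ∘ u) 0 = complexify (∫ x, u x) := by
  rw [mFourierCoeff_eq_integral_volume]
  simp only [neg_zero, mFourier_zero, ContinuousMap.one_apply, one_smul]
  rw [show (complexify ∘ u : (UnitAddTorus (Fin 3)) → (EuclideanSpace ℂ (Fin 3))) = fun x => (complexify :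
      (EuclideanSpace ℝ (Fin 3)) →ₗᵢ[ℝ] (EuclideanSpace ℂ (Fin 3))).toContinuousLinearMap (u x)
    from rfl, ContinuousLinearMap.integral_comp_comm _ hu.integrable]
  rfl

/-- **Equal zero modes, equal means**: smooth real fields with the same zero Fourier mode have the
same space average. [folklore] -/
theorem integral_eq_of_mFourierCoeff_zero_eq {u v : (UnitAddTorus (Fin 3)) → (EuclideanSpace ℝ (Fin 3))} (hu :
    IsSmooth u) (hv : IsSmooth v)
    (h : mFourierCoeff (complexify ∘ u) 0 = mFourierCoeff (complexify ∘ v) 0) : (∫ x, u x) = ∫ x, v x := by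
  rw [mFourierCoeff_complexify_zero hu, mFourierCoeff_complexify_zero hv] at h
  exact complexify_injective h

set_option maxHeartbeats 800000 in
/-- **From a rapidly decaying solution of the projected lattice equations, with any zero mode, to
a classical steady state with prescribed coefficients** (Fourier synthesis of the full family `c`,
zero mode `c(0)` = the mean included; the pressure symbol cancels the gradient part of the
residual; realness from conjugate symmetry): `𝓕(complexify ∘ u) = c`, so `⨍ u = Re c(0)`
(adapted from `SteadyLattice.steadyState_of_fourier`, dropping the mean-zero bookkeeping). [folklore] -/
theorem steadyState_of_fourier' {ν : ℝ} {f : (UnitAddTorus (Fin 3)) → (EuclideanSpace ℝ (Fin 3))} (hf : IsSmooth f)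
    (hfd : IsDivFree f) (hf0 : HasZeroMean f)
    {c : (Fin 3 → ℤ) → (EuclideanSpace ℂ (Fin 3))} (hc : RapidDecay c) (hcs : IsConjSymm c) (hct : ∀ k : (Fin 3 → ℤ),
        (∑ jj : Fin 3, ((k jj : ℤ) : ℂ) * (c k) jj) = 0)
    (heq : ∀ k : (Fin 3 → ℤ), (((ν * (4 * Real.pi ^ 2 * freqNormSq k)) : ℝ) : ℂ) • c k + Torus.lerayCoeff k
        ((WithLp.toLp 2 (fun pp : Fin 3 => transportSym (fun jj mm => c mm jj) (fun mm => c mm pp) k) : EuclideanSpace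
        ℂ (Fin 3))) =
      mFourierCoeff (complexify ∘ f) k) :
    ∃ (u : (UnitAddTorus (Fin 3)) → (EuclideanSpace ℝ (Fin 3))) (p : (UnitAddTorus (Fin 3)) → ℝ),
        Torus.IsSteadyNSState ν f u p ∧ IsSmooth u ∧
      mFourierCoeff (complexify ∘ u) = c := by
  obtain ⟨hu, hcu, hû⟩ := realSynth_spec hc hcs
  set u : (UnitAddTorus (Fin 3)) → (EuclideanSpace ℝ (Fin 3)) := fun y => EuclideanSpace.realPart (fourierSynth c
      y) with hudef
  -- the convective symbol is the coefficient family of a smooth field, hence rapidly decaying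
  have hN : ∀ k, mFourierCoeff (complexify ∘ Torus.convect u u) k = (WithLp.toLp 2 (fun pp : Fin 3 => transportSym
      (fun jj mm => c mm jj) (fun mm => c mm pp) k) : EuclideanSpace ℂ (Fin 3)) := fun k => by
    rw [mFourierCoeff_convect_real hu hu k, hû]
  have hNr : RapidDecay (fun k => (WithLp.toLp 2 (fun pp : Fin 3 => transportSym (fun jj mm => c mm jj) (fun mm => c
      mm pp) k) : EuclideanSpace ℂ (Fin 3))) := by
    have h := ((hu.convect hu).complexify_comp).rapidDecay_mFourierCoeff
    have e : mFourierCoeff (complexify ∘ Torus.convect u u) = fun k => (WithLp.toLp 2 (fun pp : Fin 3 => transportSym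
        (fun jj mm => c mm jj) (fun mm => c mm pp) k) : EuclideanSpace ℂ (Fin 3)) := funext hN
    rwa [e] at h
  set F : (Fin 3 → ℤ) → (EuclideanSpace ℂ (Fin 3)) := mFourierCoeff (complexify ∘ f) with hF
  have hFr : RapidDecay F := hf.complexify_comp.rapidDecay_mFourierCoeff
  have hFt : ∀ k : (Fin 3 → ℤ), (∑ jj : Fin 3, ((k jj : ℤ) : ℂ) * (F k) jj) = 0 :=
      fun k => hfd.sum_mul_mFourierCoeff_eq_zero hf k
  have hF0 : F 0 = 0 := mFourierCoeff_complexify_zero_of_hasZeroMean hf hf0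
  -- the pressure
  set ph : (Fin 3 → ℤ) → ℂ := fun k => (∑ jj : Fin 3, ((k jj : ℤ) : ℂ) * (F k - (WithLp.toLp 2 (fun pp : Fin
      3 => transportSym (fun jj mm => c mm jj) (fun mm => c mm pp) k) : EuclideanSpace ℂ (Fin 3))) jj) / (2 * Real.pi
      * Complex.I * ((freqNormSq k : ℝ) : ℂ)) with hph
  have hphr : RapidDecay ph := by
    have hg : RapidDecay (fun k => F k - (WithLp.toLp 2 (fun pp : Fin 3 => transportSym (fun jj mm => c mm jj) (fun
        mm => c mm pp) k) : EuclideanSpace ℂ (Fin 3))) := by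
      have := hFr.add (hNr.const_smul (-1))
      convert this using 1
      funext k; simp [sub_eq_add_neg]
    exact rapidDecay_pressureSymbol hg
  set P : (UnitAddTorus (Fin 3)) → ℂ := fourierSynth ph with hP
  have hPs : IsSmooth P := hphr.isSmooth_fourierSynth
  have hPc : ∀ k, mFourierCoeff P k = ph k := hphr.mFourierCoeff_fourierSynth
  set p : (UnitAddTorus (Fin 3)) → ℝ := fun y => (P y).re with hp
  have hps : IsSmooth p := hPs.comp_clm (G := ℝ) Complex.reCLM
  -- the complex residual vanishes
  have hEc : Continuous (fun y => complexify (Torus.convect u u y) - (ν : ℂ) • complexify (laplacian u y) +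
      Torus.gradientC P y - complexify (f y)) := by
    have c1 : Continuous fun y => complexify (Torus.convect u u y) := ((hu.convect hu).complexify_comp).continuous
    have c2 : Continuous fun y => complexify (laplacian u y) := (hu.laplacian.complexify_comp).continuous
    have c3 : Continuous fun y => Torus.gradientC P y :=
      (PiLp.continuous_toLp 2 _).comp (continuous_pi fun l => (hPs.partialDeriv l).continuous)
    have c4 : Continuous fun y => complexify (f y) := hf.complexify_comp.continuous
    exact ((c1.sub (c2.const_smul (ν : ℂ))).add c3).sub c4
  set E : (UnitAddTorus (Fin 3)) → (EuclideanSpace ℂ (Fin 3)) := fun y => complexify (Torus.convect u u y) - (ν : ℂ) •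
      complexify (laplacian u y) +
    Torus.gradientC P y - complexify (f y) with hE
  have hEcoeff : ∀ k, mFourierCoeff E k = 0 := by
    intro k
    rw [hE, mFourierCoeff_steadyResidual hu hf hPs k, hû, hPc k]
    by_cases hk : k = 0
    · subst hk
      have hn0 : (WithLp.toLp 2 (fun pp : Fin 3 => transportSym (fun jj mm => c mm jj) (fun mm => c mm pp) 0) :
          EuclideanSpace ℂ (Fin 3)) = 0 := nl_zero_of_transversal c c hct (fun j p => summable_nl_rapid hc hc 0 j p)
      rw [hn0, freqNormSq_zero, Torus.freqVec_zero, smul_zero]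
      simp [hF0, ← hF]
    · have h1 := heq k
      rw [← hF]
      have hq : ((freqNormSq k : ℝ) : ℂ) ≠ 0 := by
        exact_mod_cast (ne_of_gt (lt_of_lt_of_le one_pos (one_le_freqNormSq' hk)))
      have hI : (2 * Real.pi * Complex.I : ℂ) ≠ 0 :=
        mul_ne_zero (mul_ne_zero two_ne_zero (by exact_mod_cast Real.pi_ne_zero)) Complex.I_ne_zero
      have hsplit := sub_lerayCoeff hk ((WithLp.toLp 2 (fun pp : Fin 3 => transportSym (fun jj mm => c mm jj) (fun
          mm => c mm pp) k) : EuclideanSpace ℂ (Fin 3)))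
      have hcoef : 2 * Real.pi * Complex.I * ph k = -((∑ jj : Fin 3, ((k jj : ℤ) : ℂ) * ((WithLp.toLp 2 (fun pp : Fin
          3 => transportSym (fun jj mm => c mm jj) (fun mm => c mm pp) k) : EuclideanSpace ℂ (Fin 3))) jj) /
          ((freqNormSq k : ℝ) : ℂ)) := by
        have e : ph k = ((∑ jj : Fin 3, ((k jj : ℤ) : ℂ) * (F k) jj) - (∑ jj : Fin 3, ((k jj : ℤ) : ℂ) * ((WithLp.toLp
            2 (fun pp : Fin 3 => transportSym (fun jj mm => c mm jj) (fun mm => c mm pp) k) : EuclideanSpace ℂ (Fin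
            3))) jj)) / (2 * Real.pi * Complex.I * ((freqNormSq k : ℝ) : ℂ)) := by
          rw [hph]
          dsimp only
          rw [kdot_sub']
        rw [e, hFt k, zero_sub]
        field_simp
      rw [hcoef, neg_smul]
      have e3 : (((ν * (4 * Real.pi ^ 2 * freqNormSq k)) : ℝ) : ℂ) • c k = F k - Torus.lerayCoeff k ((WithLp.toLp 2
          (fun pp : Fin 3 => transportSym (fun jj mm => c mm jj) (fun mm => c mm pp) k) : EuclideanSpace ℂ (Fin
          3))) :=
        eq_sub_of_add_eq h1
      rw [e3]
      linear_combination (norm := module) hsplit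
  have hE0 : E = 0 := eq_zero_of_forall_mFourierCoeff_eq_zero hEc hEcoeff
  -- the real momentum equation
  have hmom : ∀ y, Torus.convect u u y = ν • laplacian u y - Torus.gradient p y + f y := by
    intro y
    have hy := congrFun hE0 y
    simp only [hE, Pi.zero_apply] at hy
    ext l
    have hl := congrArg (fun v : (EuclideanSpace ℂ (Fin 3)) => (v l).re) hy
    simp only [PiLp.sub_apply, PiLp.add_apply, PiLp.smul_apply, complexify_apply, smul_eq_mul, Complex.sub_re,
      Complex.add_re, Complex.ofReal_re, Complex.mul_re, Complex.ofReal_im, zero_mul, sub_zero,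
      PiLp.zero_apply, Complex.zero_re] at hl
    have hg : (Torus.gradientC P y l).re = Torus.gradient p y l := by
      rw [Torus.gradientC, PiLp.toLp_apply, Torus.gradient_coord (hps.isContDiff (by simp)) y l, hp]
      exact (Torus.partialDeriv_re hPs l y).symm
    rw [hg] at hl
    simp only [PiLp.sub_apply, PiLp.add_apply, PiLp.smul_apply, smul_eq_mul]
    linarith
  -- incompressibility
  have hdiv : IsDivFree u := by
    intro y
    set D : (UnitAddTorus (Fin 3)) → ℂ := fun z => ∑ l, Torus.partialDeriv l (fun w => ((u w l : ℝ) : ℂ)) z with hD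
    have hDc : Continuous D := continuous_finsetSum _ fun l _ => (((hu.apply l).ofReal).partialDeriv l).continuous
    have hDcoeff : ∀ k, mFourierCoeff D k = 0 := by
      intro k
      rw [hD, mFourierCoeff_finset_sum (f := fun l => Torus.partialDeriv l (fun w => ((u w l : ℝ) : ℂ))) _
        (fun l _ => (((hu.apply l).ofReal).partialDeriv l).integrable)]
      have h2 : ∀ l, mFourierCoeff (Torus.partialDeriv l (fun w => ((u w l : ℝ) : ℂ))) k = dsym l k * c k l :=
          fun l => by
        rw [mFourierCoeff_partialDeriv ((hu.apply l).ofReal) l k, coeff_ofReal_apply hu k l, hû, dsym_apply,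
            smul_eq_mul]
      simp only [h2, dsym_apply]
      calc ∑ l, 2 * ↑Real.pi * Complex.I * (((k l : ℤ) : ℂ)) * c k l
          = 2 * ↑Real.pi * Complex.I * (∑ jj : Fin 3, ((k jj : ℤ) : ℂ) * (c k) jj) := by
            rw [Finset.mul_sum]; exact Finset.sum_congr rfl fun l _ => by ring
        _ = 0 := by rw [hct k, mul_zero]
    have hD0 : D = 0 := eq_zero_of_forall_mFourierCoeff_eq_zero hDc hDcoeff
    have hy := congrFun hD0 y
    simp only [hD, Pi.zero_apply, partialDeriv_ofReal_apply hu] at hy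
    unfold Torus.divergence
    exact_mod_cast hy
  refine ⟨u, p, ⟨isSmoothSpaceTimeOn_const hu _, isSmoothSpaceTimeOn_const hps _, fun t _ y => ?_,
    fun _ _ => hdiv⟩, hu, hû⟩
  have ht : Torus.timeDerivWithin Set.univ (fun _ : ℝ => u) t y = 0 := by simp [Torus.timeDerivWithin]
  rw [ht, zero_add]
  exact hmom y

/-- **The drifted steady lattice equations of a classical steady state of any mean**: with
`û° = 𝓕u` punctured at `0` (the coefficients of `v = u − ⨍u`) and `M = 𝓕u(0) = ⨍u`,
`ν4π²|k|² û°(k) + 2πi (k·M) û°(k) + Π_k N(û°, û°)(k) = Π_k f̂(k)` — the Fourier form of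
`−νΔv + (m·∇)v + (v·∇)v + ∇p = f`. [folklore] -/
theorem fourier_eq_drift_of_isSteadyNSState {ν : ℝ} {f u : (UnitAddTorus (Fin 3)) → (EuclideanSpace ℝ (Fin 3))} {p :
    (UnitAddTorus (Fin 3)) → ℝ}
    (h : Torus.IsSteadyNSState ν f u p) (hf : IsSmooth f) (k : (Fin 3 → ℤ)) :
    (((ν * (4 * Real.pi ^ 2 * freqNormSq k)) : ℝ) : ℂ) • Function.update (mFourierCoeff (complexify ∘ u)) 0 0 k +
      (2 * Real.pi * Complex.I * (∑ jj : Fin 3, ((k jj : ℤ) : ℂ) * (mFourierCoeff (complexify ∘ u) 0) jj)) •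
        Function.update (mFourierCoeff (complexify ∘ u)) 0 0 k +
      Torus.lerayCoeff k ((WithLp.toLp 2 (fun pp : Fin 3 => transportSym (fun jj mm => (Function.update (mFourierCoeff
          (complexify ∘ u)) 0 0) mm jj) (fun mm => (Function.update (mFourierCoeff (complexify ∘ u)) 0 0) mm pp) k) :
          EuclideanSpace ℂ (Fin 3))) =
      Torus.lerayCoeff k (mFourierCoeff (complexify ∘ f) k) := by
  have hu : IsSmooth u := h.smooth_velocity.isSmooth_slice (Set.mem_univ 0)
  have hdiv : IsDivFree u := h.divFree 0 (Set.mem_univ 0)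
  have har : RapidDecay (mFourierCoeff (complexify ∘ u)) := hu.complexify_comp.rapidDecay_mFourierCoeff
  have hat : ∀ m : (Fin 3 → ℤ), (∑ jj : Fin 3, ((m jj : ℤ) : ℂ) * (mFourierCoeff (complexify ∘ u) m) jj) = 0 :=
      fun m =>
    hdiv.sum_mul_mFourierCoeff_eq_zero hu m
  rw [← fourier_eq_of_isSteadyNSState' h hf k, leray_nl_self_update har hat k, weight_smul_update]
  abel

/-- **From a rapidly decaying solution of the drifted steady lattice equations to a classical
steady state of prescribed mean**: for `b` rapidly decaying, conjugate symmetric, transversal with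
`b 0 = 0`, a real drift vector `M` (`conj M = M`), and
`ν4π²|k|² b(k) + 2πi (k·M) b(k) + Π_k N(b, b)(k) = f̂(k)`, the field `u = Re M + Re F_b` is a
classical steady state of `NS_ν(f)` with `𝓕(complexify ∘ u) = b + δ₀ M` (so `⨍ u = Re M`). [folklore] -/
theorem steadyState_of_fourier_drift {ν : ℝ} {f : (UnitAddTorus (Fin 3)) → (EuclideanSpace ℝ (Fin 3))} (hf : IsSmooth
    f) (hfd : IsDivFree f)
    (hf0 : HasZeroMean f) {b : (Fin 3 → ℤ) → (EuclideanSpace ℂ (Fin 3))} (hb : RapidDecay b) (hbs : IsConjSymm b)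
    (hbt : ∀ k : (Fin 3 → ℤ), (∑ jj : Fin 3, ((k jj : ℤ) : ℂ) * (b k) jj) = 0) (hb0 : b 0 = 0) {M : (EuclideanSpace ℂ
        (Fin 3))} (hM : conjVec M = M)
    (heq : ∀ k : (Fin 3 → ℤ), (((ν * (4 * Real.pi ^ 2 * freqNormSq k)) : ℝ) : ℂ) • b k +
      (2 * Real.pi * Complex.I * (∑ jj : Fin 3, ((k jj : ℤ) : ℂ) * M jj)) • b k + Torus.lerayCoeff k ((WithLp.toLp 2
          (fun pp : Fin 3 => transportSym (fun jj mm => b mm jj) (fun mm => b mm pp) k) : EuclideanSpace ℂ (Fin 3))) =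
          mFourierCoeff (complexify ∘ f) k) :
    ∃ (u : (UnitAddTorus (Fin 3)) → (EuclideanSpace ℝ (Fin 3))) (p : (UnitAddTorus (Fin 3)) → ℝ),
        Torus.IsSteadyNSState ν f u p ∧ IsSmooth u ∧
      mFourierCoeff (complexify ∘ u) = b + (Pi.single (0 : (Fin 3 → ℤ)) M : (Fin 3 → ℤ) → (EuclideanSpace ℂ (Fin
          3))) := by
  have hc₁r : RapidDecay (b + (Pi.single (0 : (Fin 3 → ℤ)) M : (Fin 3 → ℤ) → (EuclideanSpace ℂ (Fin 3)))) := hb.add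
      (rapidDecay_single _)
  have hc₁cs : IsConjSymm (b + (Pi.single (0 : (Fin 3 → ℤ)) M : (Fin 3 → ℤ) → (EuclideanSpace ℂ (Fin 3)))) := hbs.add
      (isConjSymm_single hM)
  have hc₁t : ∀ k : (Fin 3 → ℤ), (∑ jj : Fin 3, ((k jj : ℤ) : ℂ) * ((b + (Pi.single (0 : (Fin 3 → ℤ)) M : (Fin 3 → ℤ)
      → (EuclideanSpace ℂ (Fin 3))) : (Fin 3 → ℤ) → (EuclideanSpace ℂ (Fin 3))) k) jj) = 0 := fun k => by
    rw [Pi.add_apply, kdot_add, hbt k, single_transversal, add_zero]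
  have hupd : Function.update (b + (Pi.single (0 : (Fin 3 → ℤ)) M : (Fin 3 → ℤ) → (EuclideanSpace ℂ (Fin 3)))) 0 0 =
      b := update_add_single_of_zero hb0 _
  have hc₁0 : (b + (Pi.single (0 : (Fin 3 → ℤ)) M : (Fin 3 → ℤ) → (EuclideanSpace ℂ (Fin 3))) : (Fin 3 → ℤ) →
      (EuclideanSpace ℂ (Fin 3))) 0 = M := add_single_apply_zero hb0 _
  refine steadyState_of_fourier' hf hfd hf0 hc₁r hc₁cs hc₁t fun k => ?_
  rw [leray_nl_self_update hc₁r hc₁t k, ← weight_smul_update (b + (Pi.single (0 : (Fin 3 → ℤ)) M : (Fin 3 → ℤ) →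
      (EuclideanSpace ℂ (Fin 3)))) k, hupd, hc₁0,
    ← heq k]
  abel

end Dictionary

/-! ## §E Assembly: persistence of leaf-nondegenerate steady states with arbitrary mean -/

section Assembly

variable {S : Finset (Fin 3 → ℤ)}

set_option maxHeartbeats 1600000 in
/-- **Steady implicit-function theorem at fixed viscosity in a conserved-mean leaf** (Temam 1979
Ch. II §1, Thm. 1.3 and its proof; Foias–Temam 1977 §1; Saut–Temam 1980 §2 — run for the drifted
steady system `−νΔv + (m·∇)v + (v·∇)v + ∇p = f`, `m = ⨍ u₀`): a classical steady state `u₀` of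
`NS_ν(f_c)`, `ν > 0`, `f_c = realTrigPoly S (Π ĉ)`, of ARBITRARY mean, whose linearisation
`L(ν,u₀)` has no classical kernel in the mean-zero class (`¬ Torus.IsLinNSEigenvalue ν u₀ 0`, i.e.
nondegeneracy in the leaf `{⨍ u = ⨍ u₀}`), persists under small changes of `c` as a classical
steady state of `NS_ν(f_{c'})` with the SAME mean, `H¹`-close to `u₀`:
`∀ δ > 0 ∃ r > 0 ∀ c', dist c' c < r → ∃ u' p', … ∧ ∫ u' = ∫ u₀ ∧ ∫‖u' − u₀‖² + ‖∇(u' − u₀)‖₂² < δ`.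
Proof: base point `x₀ = (|k|² û₀(k))_{k≠0} ∈ W`; steady map `G(x) = 4π²ν x + D_m x + B(x,x)` with
the compact drift multiplier `D_m` (`exists_drift`); `DG(x₀) = 4π²ν + (D_m + K)`, `D_m + K`
compact; a kernel vector is rapidly decaying (`SteadyLattice.rapidDecay_of_linearised_eq` with the
full family `û₀`, drift inside `N(û₀,·)`) hence a classical eigenvector
(`SteadyLattice.isLinNSEigenvalue_of_fourier`), excluded; Fredholm + inverse function theorem
(`SteadyLattice.exists_equiv_of_injective`, `local_solve`); the perturbed solution is rapidly
decaying (`rapidDecay_of_perturbed_eq` with `a = δ₀ m`) and synthesises, with the zero mode `m`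
restored, a classical steady state of mean `⨍ u₀` (`steadyState_of_fourier'`); the `H¹` estimate
is Parseval (`SteadyLattice.h1_le_of_coeff`). [folklore] -/
theorem steadyPersistsInLeaf_of_nondeg {c : (↥S → EuclideanSpace ℂ (Fin 3))} {ν : ℝ} (hν : 0 < ν)
    {u₀ : (UnitAddTorus (Fin 3)) → (EuclideanSpace ℝ (Fin 3))} {p₀ : (UnitAddTorus (Fin 3)) → ℝ}
    (hst : Torus.IsSteadyNSState ν (realTrigPoly S (fun k => Torus.lerayCoeff k (coeffExt S c k))) u₀ p₀)
    (hnd : ¬ Torus.IsLinNSEigenvalue ν u₀ 0) :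
    ∀ δ : ℝ, 0 < δ → ∃ r : ℝ, 0 < r ∧ ∀ c' : (↥S → EuclideanSpace ℂ (Fin 3)), dist c' c < r →
      ∃ (u' : (UnitAddTorus (Fin 3)) → (EuclideanSpace ℝ (Fin 3))) (p' : (UnitAddTorus (Fin 3)) → ℝ),
        Torus.IsSteadyNSState ν (realTrigPoly S (fun k => Torus.lerayCoeff k (coeffExt S c' k))) u' p' ∧
          (∫ x, u' x) = (∫ x, u₀ x) ∧
          (∫ x, ‖u' x - u₀ x‖ ^ 2) + gradNormSq (fun x => u' x - u₀ x) < δ := by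
  intro δ hδ
  -- §1 the unperturbed state on the Fourier side (full family, zero mode = the mean)
  have hu₀ : IsSmooth u₀ := hst.smooth_velocity.isSmooth_slice (Set.mem_univ 0)
  have hdiv₀ : IsDivFree u₀ := hst.divFree 0 (Set.mem_univ 0)
  set a : (Fin 3 → ℤ) → (EuclideanSpace ℂ (Fin 3)) := mFourierCoeff (complexify ∘ u₀) with ha
  have har : RapidDecay a := hu₀.complexify_comp.rapidDecay_mFourierCoeff
  have hat : ∀ m : (Fin 3 → ℤ), (∑ jj : Fin 3, ((m jj : ℤ) : ℂ) * (a m) jj) = 0 :=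
      fun m => hdiv₀.sum_mul_mFourierCoeff_eq_zero hu₀ m
  have hacs : IsConjSymm a := isConjSymm_mFourierCoeff hu₀.integrable
  have hM : conjVec (a 0) = a 0 := by
    have h := hacs 0
    rw [neg_zero] at h
    exact h.symm
  have hbr : RapidDecay (Function.update a 0 0) := rapidDecay_update har
  have heq₀ : ∀ k : (Fin 3 → ℤ), (((ν * (4 * Real.pi ^ 2 * freqNormSq k)) : ℝ) : ℂ) • a k + Torus.lerayCoeff k
      ((WithLp.toLp 2 (fun pp : Fin 3 => transportSym (fun jj mm => a mm jj) (fun mm => a mm pp) k) : EuclideanSpace ℂ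
      (Fin 3))) =
      mFourierCoeff (complexify ∘ realTrigPoly S (fun k => Torus.lerayCoeff k (coeffExt S c k))) k := fun k => by
    rw [ha, fourier_eq_of_isSteadyNSState' hst (isSmooth_projForce c) k, lerayCoeff_projForceCoeff]
  -- §2 the state space, the bilinear map, the force map, the drift
  obtain ⟨W, hW, hWc⟩ := exists_space
  haveI : CompleteSpace W := completeSpace_W hWc
  obtain ⟨B, hB, hBb⟩ := exists_bilinear hW
  obtain ⟨Fm, hFm⟩ := exists_projForceMap (S := S) hW
  obtain ⟨D, hD, hDc⟩ := exists_drift hW hWc hM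
  -- §3 the base point `x₀` (its physical coefficients are the punctured family `a°`)
  set X₀ : (Fin 3 → ℤ) → (EuclideanSpace ℂ (Fin 3)) := fun k => ((freqNormSq k : ℝ) : ℂ) • a k with hX₀
  have hX₀r : RapidDecay X₀ := by
    refine har.of_norm_le_mul_pow (C := 1) (s := 1) fun k => ?_
    rw [hX₀]
    dsimp only
    rw [norm_smul, Complex.norm_real, Real.norm_of_nonneg (freqNormSq_nonneg k), one_mul, pow_one]
    exact mul_le_mul_of_nonneg_right (by linarith [freqNormSq_nonneg k]) (norm_nonneg _)
  have hX00 : X₀ 0 = 0 := by simp [hX₀, freqNormSq_zero]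
  have hX₀V : ((X₀ : (Fin 3 → ℤ) → EuclideanSpace ℂ (Fin 3)) 0 = 0 ∧ (∀ kk : Fin 3 → ℤ, (∑ jj : Fin 3, ((kk jj : ℤ) :
      ℂ) * ((X₀ : (Fin 3 → ℤ) → EuclideanSpace ℂ (Fin 3)) kk) jj) = 0) ∧ IsConjSymm (X₀ : (Fin 3 → ℤ) → EuclideanSpace
      ℂ (Fin 3))) := by
    refine ⟨hX00, fun k => by rw [hX₀]; dsimp only; rw [kdot_smul, hat k, mul_zero], fun k => ?_⟩
    rw [hX₀]
    dsimp only
    rw [freqNormSq_neg, hacs k, conjVec_smul, Complex.conj_ofReal]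
  set x₀ : W := ⟨⟨X₀, memℓp_two_of_rapidDecay hX₀r⟩, (hW _).2 hX₀V⟩ with hx₀def
  have hx₀ : ((x₀ : (lp (fun _ : Fin 3 → ℤ => EuclideanSpace ℂ (Fin 3)) 2)) : (Fin 3 → ℤ) → (EuclideanSpace ℂ (Fin
      3))) = X₀ := rfl
  have hcfX : ((fun mm : Fin 3 → ℤ => (((freqNormSq mm)⁻¹ : ℝ) : ℂ)) • (X₀ : (Fin 3 → ℤ) → EuclideanSpace ℂ (Fin 3)))
      = Function.update a 0 0 := by rw [hX₀]; exact cf_weight_smul' a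
  have hcf : ((fun mm : Fin 3 → ℤ => (((freqNormSq mm)⁻¹ : ℝ) : ℂ)) • (((x₀ : (lp (fun _ : Fin 3 → ℤ => EuclideanSpace
      ℂ (Fin 3)) 2)) : (Fin 3 → ℤ) → (EuclideanSpace ℂ (Fin 3))) : (Fin 3 → ℤ) → EuclideanSpace ℂ (Fin 3))) =
      Function.update a 0 0 := by rw [hx₀]; exact hcfX
  -- §4 the drifted steady map and its derivative
  set cν : ℝ := 4 * Real.pi ^ 2 * ν with hcν
  have hcν0 : cν ≠ 0 := by positivity
  set G : W → W := fun x => cν • x + D x + B x x with hG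
  set K : W →L[ℝ] W := (hBb.deriv (x₀, x₀)).comp ((ContinuousLinearMap.id ℝ W).prod (ContinuousLinearMap.id ℝ W))
    with hK
  have hKw : ∀ w, K w = B x₀ w + B w x₀ := fun w => by simp [hK, IsBoundedBilinearMap.deriv_apply]
  have hGd : HasStrictFDerivAt G (cν • ContinuousLinearMap.id ℝ W + (D + K)) x₀ := by
    have h := (hasStrictFDerivAt_steadyMap hBb cν x₀).add (D.hasStrictFDerivAt (x := x₀))
    have e : G = fun x => (cν • x + B x x) + D x := by
      funext x
      simp only [hG]
      abel
    rw [e]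
    refine h.congr_fderiv ?_
    rw [hK]
    abel
  have hKc : IsCompactOperator K := isCompactOperator_linearised hWc hB x₀ (by rw [hcf]; exact hbr) K hKw
  have hDKc : IsCompactOperator (D + K) := hDc.add hKc
  -- coordinates of `G`
  have hGcoe : ∀ x : W, (((G x : W) : (lp (fun _ : Fin 3 → ℤ => EuclideanSpace ℂ (Fin 3)) 2)) : (Fin 3 → ℤ) →
      (EuclideanSpace ℂ (Fin 3))) = fun k => ((cν : ℝ) : ℂ) • ((x : (lp (fun _ : Fin 3 → ℤ => EuclideanSpace ℂ (Fin
      3)) 2)) : (Fin 3 → ℤ) → (EuclideanSpace ℂ (Fin 3))) k +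
      (2 * Real.pi * Complex.I * (∑ jj : Fin 3, ((k jj : ℤ) : ℂ) * (a 0) jj)) • (((fun mm : Fin 3 → ℤ => (((freqNormSq
          mm)⁻¹ : ℝ) : ℂ)) • (((x : (lp (fun _ : Fin 3 → ℤ => EuclideanSpace ℂ (Fin 3)) 2)) : (Fin 3 → ℤ) →
          (EuclideanSpace ℂ (Fin 3))) : (Fin 3 → ℤ) → EuclideanSpace ℂ (Fin 3)))) k +
      Torus.lerayCoeff k ((WithLp.toLp 2 (fun pp : Fin 3 => transportSym (fun jj mm => (((fun mm : Fin 3 →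
          ℤ => (((freqNormSq mm)⁻¹ : ℝ) : ℂ)) • (((x : (lp (fun _ : Fin 3 → ℤ => EuclideanSpace ℂ (Fin 3)) 2)) : (Fin
          3 → ℤ) → (EuclideanSpace ℂ (Fin 3))) : (Fin 3 → ℤ) → EuclideanSpace ℂ (Fin 3)))) mm jj) (fun mm => (((fun
          mm : Fin 3 → ℤ => (((freqNormSq mm)⁻¹ : ℝ) : ℂ)) • (((x : (lp (fun _ : Fin 3 → ℤ => EuclideanSpace ℂ (Fin
          3)) 2)) : (Fin 3 → ℤ) → (EuclideanSpace ℂ (Fin 3))) : (Fin 3 → ℤ) → EuclideanSpace ℂ (Fin 3)))) mm pp) k) :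
          EuclideanSpace ℂ (Fin 3))) := by
    intro x
    rw [hG]
    dsimp only
    rw [coeW_add, coeW_add, coeW_smul, hB, hD]
    funext k
    simp only [Pi.add_apply, Pi.smul_apply, Complex.coe_smul]
  -- §5 injectivity of the linearisation (regularity + the spectral hypothesis, full family `û₀`)
  have hinj : ∀ w : W, cν • w + (D + K) w = 0 → w = 0 := by
    intro w hw0
    have hco : ∀ k : (Fin 3 → ℤ), (((4 * Real.pi ^ 2 * ν : ℝ)) : ℂ) • ((w : (lp (fun _ : Fin 3 → ℤ => EuclideanSpace ℂ
        (Fin 3)) 2)) : (Fin 3 → ℤ) → (EuclideanSpace ℂ (Fin 3))) k +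
        Torus.lerayCoeff k ((WithLp.toLp 2 (fun pp : Fin 3 => transportSym (fun jj mm => a mm jj) (fun mm => (((fun
            mm : Fin 3 → ℤ => (((freqNormSq mm)⁻¹ : ℝ) : ℂ)) • (((w : (lp (fun _ : Fin 3 → ℤ => EuclideanSpace ℂ (Fin
            3)) 2)) : (Fin 3 → ℤ) → (EuclideanSpace ℂ (Fin 3))) : (Fin 3 → ℤ) → EuclideanSpace ℂ (Fin 3)))) mm pp)
            k) : EuclideanSpace ℂ (Fin 3)) + (WithLp.toLp 2 (fun pp : Fin 3 => transportSym (fun jj mm => (((fun mm :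
            Fin 3 → ℤ => (((freqNormSq mm)⁻¹ : ℝ) : ℂ)) • (((w : (lp (fun _ : Fin 3 → ℤ => EuclideanSpace ℂ (Fin 3))
            2)) : (Fin 3 → ℤ) → (EuclideanSpace ℂ (Fin 3))) : (Fin 3 → ℤ) → EuclideanSpace ℂ (Fin 3)))) mm jj) (fun
            mm => a mm pp) k) : EuclideanSpace ℂ (Fin 3))) = 0 := by
      intro k
      have h := congrArg (fun z : W => (((z : W) : (lp (fun _ : Fin 3 → ℤ => EuclideanSpace ℂ (Fin 3)) 2)) : (Fin 3 →
          ℤ) → (EuclideanSpace ℂ (Fin 3))) k) hw0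
      dsimp only at h
      rw [coeW_add, add_apply, coeW_add, hKw, coeW_add, coeW_smul, hB, hB, hD, hcf] at h
      simp only [Pi.add_apply, Pi.smul_apply] at h
      rw [← Complex.coe_smul, Submodule.coe_zero] at h
      rw [← hcν, leray_nl_linearised_update har (w : (lp (fun _ : Fin 3 → ℤ => EuclideanSpace ℂ (Fin 3)) 2)) (W_trans
          hW w) k]
      calc _ = ((cν : ℝ) : ℂ) • ((w : (lp (fun _ : Fin 3 → ℤ => EuclideanSpace ℂ (Fin 3)) 2)) : (Fin 3 → ℤ) →
              (EuclideanSpace ℂ (Fin 3))) k +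
            ((2 * Real.pi * Complex.I * (∑ jj : Fin 3, ((k jj : ℤ) : ℂ) * (a 0) jj)) • (((fun mm : Fin 3 →
                ℤ => (((freqNormSq mm)⁻¹ : ℝ) : ℂ)) • (((w : (lp (fun _ : Fin 3 → ℤ => EuclideanSpace ℂ (Fin 3)) 2)) :
                (Fin 3 → ℤ) → (EuclideanSpace ℂ (Fin 3))) : (Fin 3 → ℤ) → EuclideanSpace ℂ (Fin 3)))) k +
              (Torus.lerayCoeff k ((WithLp.toLp 2 (fun pp : Fin 3 => transportSym (fun jj mm => (Function.update a 0
                  0) mm jj) (fun mm => (((fun mm : Fin 3 → ℤ => (((freqNormSq mm)⁻¹ : ℝ) : ℂ)) • (((w : (lp (fun _ :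
                  Fin 3 → ℤ => EuclideanSpace ℂ (Fin 3)) 2)) : (Fin 3 → ℤ) → (EuclideanSpace ℂ (Fin 3))) : (Fin 3 → ℤ)
                  → EuclideanSpace ℂ (Fin 3)))) mm pp) k) : EuclideanSpace ℂ (Fin 3))) +
                Torus.lerayCoeff k ((WithLp.toLp 2 (fun pp : Fin 3 => transportSym (fun jj mm => (((fun mm : Fin 3 →
                    ℤ => (((freqNormSq mm)⁻¹ : ℝ) : ℂ)) • (((w : (lp (fun _ : Fin 3 → ℤ => EuclideanSpace ℂ (Fin 3))
                    2)) : (Fin 3 → ℤ) → (EuclideanSpace ℂ (Fin 3))) : (Fin 3 → ℤ) → EuclideanSpace ℂ (Fin 3)))) mm jj)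
                    (fun mm => (Function.update a 0 0) mm pp) k) : EuclideanSpace ℂ (Fin 3))))) := by abel
        _ = _ := h
    have hwr : RapidDecay (((fun mm : Fin 3 → ℤ => (((freqNormSq mm)⁻¹ : ℝ) : ℂ)) • (((w : (lp (fun _ : Fin 3 →
        ℤ => EuclideanSpace ℂ (Fin 3)) 2)) : (Fin 3 → ℤ) → (EuclideanSpace ℂ (Fin 3))) : (Fin 3 → ℤ) → EuclideanSpace
        ℂ (Fin 3)))) :=
      rapidDecay_of_linearised_eq hν har hat (w : (lp (fun _ : Fin 3 → ℤ => EuclideanSpace ℂ (Fin 3)) 2)) (W_trans hW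
          w) hco
    by_contra hwne
    have hcfne : ((fun mm : Fin 3 → ℤ => (((freqNormSq mm)⁻¹ : ℝ) : ℂ)) • (((w : (lp (fun _ : Fin 3 →
        ℤ => EuclideanSpace ℂ (Fin 3)) 2)) : (Fin 3 → ℤ) → (EuclideanSpace ℂ (Fin 3))) : (Fin 3 → ℤ) → EuclideanSpace
        ℂ (Fin 3))) ≠ 0 := by
      intro hz
      apply hwne
      refine Subtype.ext (lp.ext (funext fun k => ?_))
      rw [Submodule.coe_zero]
      change ((w : (lp (fun _ : Fin 3 → ℤ => EuclideanSpace ℂ (Fin 3)) 2)) : (Fin 3 → ℤ) → (EuclideanSpace ℂ (Fin 3)))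
          k = 0
      by_cases hk : k = 0
      · subst hk; exact W_zero hW w
      · have h := congrFun hz k
        rw [cf_apply, Pi.zero_apply, smul_eq_zero] at h
        rcases h with h | h
        · exfalso
          have hf : freqNormSq k ≠ 0 := ne_of_gt (lt_of_lt_of_le one_pos (one_le_freqNormSq' hk))
          exact hf (inv_eq_zero.1 (by exact_mod_cast h))
        · exact h
    have heqc : ∀ k : (Fin 3 → ℤ), (((ν * (4 * Real.pi ^ 2 * freqNormSq k)) : ℝ) : ℂ) • (((fun mm : Fin 3 →
        ℤ => (((freqNormSq mm)⁻¹ : ℝ) : ℂ)) • (((w : (lp (fun _ : Fin 3 → ℤ => EuclideanSpace ℂ (Fin 3)) 2)) : (Fin 3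
        → ℤ) → (EuclideanSpace ℂ (Fin 3))) : (Fin 3 → ℤ) → EuclideanSpace ℂ (Fin 3)))) k +
        Torus.lerayCoeff k ((WithLp.toLp 2 (fun pp : Fin 3 => transportSym (fun jj mm => a mm jj) (fun mm => (((fun
            mm : Fin 3 → ℤ => (((freqNormSq mm)⁻¹ : ℝ) : ℂ)) • (((w : (lp (fun _ : Fin 3 → ℤ => EuclideanSpace ℂ (Fin
            3)) 2)) : (Fin 3 → ℤ) → (EuclideanSpace ℂ (Fin 3))) : (Fin 3 → ℤ) → EuclideanSpace ℂ (Fin 3)))) mm pp)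
            k) : EuclideanSpace ℂ (Fin 3)) + (WithLp.toLp 2 (fun pp : Fin 3 => transportSym (fun jj mm => (((fun mm :
            Fin 3 → ℤ => (((freqNormSq mm)⁻¹ : ℝ) : ℂ)) • (((w : (lp (fun _ : Fin 3 → ℤ => EuclideanSpace ℂ (Fin 3))
            2)) : (Fin 3 → ℤ) → (EuclideanSpace ℂ (Fin 3))) : (Fin 3 → ℤ) → EuclideanSpace ℂ (Fin 3)))) mm jj) (fun
            mm => a mm pp) k) : EuclideanSpace ℂ (Fin 3))) = 0 := fun k => by
      rw [← smul_eq_weight_smul_cf (W_zero hW w) k]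
      exact hco k
    exact hnd (isLinNSEigenvalue_of_fourier hu₀ hdiv₀ hwr (cf_transversal (W_trans hW w)) (cf_zero _) hcfne heqc)
  -- §6 the derivative is an isomorphism; local inversion
  obtain ⟨L, hL⟩ := exists_equiv_of_injective hDKc hcν0 hinj
  have hLeq : (L : W →L[ℝ] W) = cν • ContinuousLinearMap.id ℝ W + (D + K) := by
    ext w
    simp [hL w]
  have hGd' : HasStrictFDerivAt G (L : W →L[ℝ] W) x₀ := by rw [hLeq]; exact hGd
  have hGx₀ : G x₀ = Fm c := by
    refine Subtype.ext (lp.ext (funext fun k => ?_))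
    rw [hGcoe, hFm]
    dsimp only
    rw [hx₀, smul_eq_weight_smul_cf hX00 k, hcfX, ← heq₀ k, leray_nl_self_update har hat k, weight_smul_update]
    abel
  -- radii
  set δ' : ℝ := min 1 (δ / (2 * (1 + 4 * Real.pi ^ 2))) with hδ'
  have hδ'0 : 0 < δ' := lt_min one_pos (by positivity)
  have hδ'1 : δ' ≤ 1 := min_le_left _ _
  have hδ'2 : δ' ≤ δ / (2 * (1 + 4 * Real.pi ^ 2)) := min_le_right _ _
  obtain ⟨r, hr, hsolve⟩ := local_solve hGd' hδ'0
  have hFc : Continuous Fm := LinearMap.continuous_of_finiteDimensional Fm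
  obtain ⟨r', hr', hball⟩ := Metric.continuous_iff.1 hFc c r hr
  refine ⟨r', hr', fun c' hc' => ?_⟩
  obtain ⟨x, hGx, hdist⟩ := hsolve (Fm c') (by rw [hGx₀]; exact hball c' hc')
  -- §7 the perturbed solution is a classical steady state with the same mean
  have hxeq : ∀ k : (Fin 3 → ℤ), (((cν : ℝ)) : ℂ) • ((x : (lp (fun _ : Fin 3 → ℤ => EuclideanSpace ℂ (Fin 3)) 2)) :
      (Fin 3 → ℤ) → (EuclideanSpace ℂ (Fin 3))) k +
      (2 * Real.pi * Complex.I * (∑ jj : Fin 3, ((k jj : ℤ) : ℂ) * (a 0) jj)) • (((fun mm : Fin 3 → ℤ => (((freqNormSq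
          mm)⁻¹ : ℝ) : ℂ)) • (((x : (lp (fun _ : Fin 3 → ℤ => EuclideanSpace ℂ (Fin 3)) 2)) : (Fin 3 → ℤ) →
          (EuclideanSpace ℂ (Fin 3))) : (Fin 3 → ℤ) → EuclideanSpace ℂ (Fin 3)))) k +
      Torus.lerayCoeff k ((WithLp.toLp 2 (fun pp : Fin 3 => transportSym (fun jj mm => (((fun mm : Fin 3 →
          ℤ => (((freqNormSq mm)⁻¹ : ℝ) : ℂ)) • (((x : (lp (fun _ : Fin 3 → ℤ => EuclideanSpace ℂ (Fin 3)) 2)) : (Fin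
          3 → ℤ) → (EuclideanSpace ℂ (Fin 3))) : (Fin 3 → ℤ) → EuclideanSpace ℂ (Fin 3)))) mm jj) (fun mm => (((fun
          mm : Fin 3 → ℤ => (((freqNormSq mm)⁻¹ : ℝ) : ℂ)) • (((x : (lp (fun _ : Fin 3 → ℤ => EuclideanSpace ℂ (Fin
          3)) 2)) : (Fin 3 → ℤ) → (EuclideanSpace ℂ (Fin 3))) : (Fin 3 → ℤ) → EuclideanSpace ℂ (Fin 3)))) mm pp) k) :
          EuclideanSpace ℂ (Fin 3))) =
      mFourierCoeff (complexify ∘ realTrigPoly S (fun k => Torus.lerayCoeff k (coeffExt S c' k))) k := by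
    intro k
    have h := congrArg (fun z : W => (((z : W) : (lp (fun _ : Fin 3 → ℤ => EuclideanSpace ℂ (Fin 3)) 2)) : (Fin 3 → ℤ)
        → (EuclideanSpace ℂ (Fin 3))) k) hGx
    dsimp only at h
    rw [hGcoe, hFm] at h
    exact h
  have hxr : RapidDecay (((fun mm : Fin 3 → ℤ => (((freqNormSq mm)⁻¹ : ℝ) : ℂ)) • (((x : (lp (fun _ : Fin 3 →
      ℤ => EuclideanSpace ℂ (Fin 3)) 2)) : (Fin 3 → ℤ) → (EuclideanSpace ℂ (Fin 3))) : (Fin 3 → ℤ) → EuclideanSpace ℂ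
      (Fin 3)))) :=
    rapidDecay_of_perturbed_eq hν (rapidDecay_single (a 0)) (single_transversal (a 0)) (x : (lp (fun _ : Fin 3 →
        ℤ => EuclideanSpace ℂ (Fin 3)) 2)) (W_trans hW x)
      (fun s => tsum_weight_mul_enorm_ne_top_of_rapidDecay (rapidDecay_projForceCoeff c') s)
      (fun k => by
        rw [leray_nl_linearised_single (a 0) (W_trans hW x) k, ← hcν]
        exact hxeq k)
  -- the full family of the perturbed state: zero mode restored
  set c₁ : (Fin 3 → ℤ) → (EuclideanSpace ℂ (Fin 3)) := ((fun mm : Fin 3 → ℤ => (((freqNormSq mm)⁻¹ : ℝ) : ℂ)) • (((x :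
      (lp (fun _ : Fin 3 → ℤ => EuclideanSpace ℂ (Fin 3)) 2)) : (Fin 3 → ℤ) → (EuclideanSpace ℂ (Fin 3))) : (Fin 3 →
      ℤ) → EuclideanSpace ℂ (Fin 3))) + (Pi.single (0 : (Fin 3 → ℤ)) (a 0) : (Fin 3 → ℤ) → (EuclideanSpace ℂ (Fin
      3))) with hc₁
  have hc₁r : RapidDecay c₁ := hxr.add (rapidDecay_single _)
  have hc₁cs : IsConjSymm c₁ := (isConjSymm_cf (W_conj hW x)).add (isConjSymm_single hM)
  have hc₁t : ∀ k : (Fin 3 → ℤ), (∑ jj : Fin 3, ((k jj : ℤ) : ℂ) * (c₁ k) jj) = 0 := fun k => by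
    rw [hc₁, Pi.add_apply, kdot_add, cf_transversal (W_trans hW x) k, single_transversal, add_zero]
  have hupd : Function.update c₁ 0 0 = ((fun mm : Fin 3 → ℤ => (((freqNormSq mm)⁻¹ : ℝ) : ℂ)) • (((x : (lp (fun _ :
      Fin 3 → ℤ => EuclideanSpace ℂ (Fin 3)) 2)) : (Fin 3 → ℤ) → (EuclideanSpace ℂ (Fin 3))) : (Fin 3 → ℤ) →
      EuclideanSpace ℂ (Fin 3))) := update_add_single_of_zero (cf_zero _) _
  have hc₁0 : c₁ 0 = a 0 := add_single_apply_zero (cf_zero _) _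
  have heq₁ : ∀ k : (Fin 3 → ℤ), (((ν * (4 * Real.pi ^ 2 * freqNormSq k)) : ℝ) : ℂ) • c₁ k + Torus.lerayCoeff k
      ((WithLp.toLp 2 (fun pp : Fin 3 => transportSym (fun jj mm => c₁ mm jj) (fun mm => c₁ mm pp) k) : EuclideanSpace
      ℂ (Fin 3))) =
      mFourierCoeff (complexify ∘ realTrigPoly S (fun k => Torus.lerayCoeff k (coeffExt S c' k))) k := by
    intro k
    rw [leray_nl_self_update hc₁r hc₁t k, ← weight_smul_update c₁ k, hupd, hc₁0, ← hxeq k,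
      smul_eq_weight_smul_cf (W_zero hW x) k]
    abel
  obtain ⟨u', p', hst', hu', hû'⟩ := steadyState_of_fourier' (isSmooth_projForce c') (isDivFree_projForce c')
    (hasZeroMean_projForce c') hc₁r hc₁cs hc₁t heq₁
  refine ⟨u', p', hst', integral_eq_of_mFourierCoeff_zero_eq hu' hu₀ (by rw [hû', hc₁0]), ?_⟩
  -- §8 the `H¹` estimate
  set z : W := x - x₀ with hz
  have hzn : ‖z‖ < δ' := by rwa [hz, ← dist_eq_norm]
  have hv : IsSmooth (fun y => u' y - u₀ y) := hu'.sub hu₀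
  have hcoefv : mFourierCoeff (complexify ∘ fun y => u' y - u₀ y) = ((fun mm : Fin 3 → ℤ => (((freqNormSq mm)⁻¹ : ℝ) :
      ℂ)) • ((((z : W) : (lp (fun _ : Fin 3 → ℤ => EuclideanSpace ℂ (Fin 3)) 2)) : (Fin 3 → ℤ) → (EuclideanSpace ℂ
      (Fin 3))) : (Fin 3 → ℤ) → EuclideanSpace ℂ (Fin 3))) := by
    have e : (complexify ∘ fun y => u' y - u₀ y : (UnitAddTorus (Fin 3)) → (EuclideanSpace ℂ (Fin 3))) = (complexify
        ∘ u') - (complexify ∘ u₀) := by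
      funext y; simp
    rw [e, hz, coeW_sub]
    funext k
    rw [mFourierCoeff_sub hu'.complexify_comp.integrable hu₀.complexify_comp.integrable, hû', ← ha]
    have hak : a k = Function.update a 0 0 k + (Pi.single (0 : (Fin 3 → ℤ)) (a 0) : (Fin 3 → ℤ) → (EuclideanSpace ℂ
        (Fin 3))) k :=
      (congrFun (update_add_single a) k).symm
    rw [hak, ← hcf, hc₁]
    simp only [Pi.add_apply, Pi.smul_apply', Pi.sub_apply, smul_sub]
    abel
  have hH := h1_le_of_coeff hv (z : (lp (fun _ : Fin 3 → ℤ => EuclideanSpace ℂ (Fin 3)) 2)) hcoefv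
  rw [norm_coeW] at hH
  have hpi : (0 : ℝ) < 1 + 4 * Real.pi ^ 2 := by positivity
  have hz2 : ‖z‖ ^ 2 ≤ δ' * δ' := by
    have := norm_nonneg z
    nlinarith
  have hd : δ' * δ' ≤ δ' := by nlinarith
  calc (∫ y, ‖u' y - u₀ y‖ ^ 2) + gradNormSq (fun y => u' y - u₀ y) ≤ (1 + 4 * Real.pi ^ 2) * ‖z‖ ^ 2 := hH
    _ ≤ (1 + 4 * Real.pi ^ 2) * δ' := by nlinarith
    _ ≤ (1 + 4 * Real.pi ^ 2) * (δ / (2 * (1 + 4 * Real.pi ^ 2))) := mul_le_mul_of_nonneg_left hδ'2 hpi.le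
    _ = δ / 2 := by field_simp
    _ < δ := by linarith

end Assembly

end SteadyLatticeDrift

end Literature.Analysis.FluidPDE

end
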